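import Literature.NumberTheory.DiophantineGeometry.BombieriPilaImplicitDerivatives
import Literature.NumberTheory.DiophantineGeometry.BombieriPilaMainLemma
import Mathlib.RingTheory.MvPolynomial.MonomialOrder.DegLex
import Mathlib.Analysis.Calculus.Taylor
import Mathlib.Analysis.Calculus.MeanValue
import HarnessLib

/-!
# Bombieri–Pila, Theorem 4 in `N^{1/d+ε}` form

Proof of the named fact `bombieriPila_graph_card_le` of `BombieriPilaSteps`
(`bombieriPila_graph_card_le_holds`): for every `d ≥ 2`, `ε > 0` there is `B(d, ε)` such that
a `C^∞` branch of slope `≤ 1` of an absolutely irreducible real plane curve of degree `d`, over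
an open interval of length `≤ N` (`N ≥ 1`), carries at most `B N^{1/d+ε}` integral points.
This is Theorem 4 of [BombieriPila1989] (there with the explicit factor
`exp(11 √(d log N log log N))` for `N ≥ exp(d⁶)`) in the weaker `N^ε` form, which allows two
simplifications of the printed proof: the parameter `δ` is chosen depending on `d, ε` only
(`δ = max(2d, ⌈8/ε⌉)`, so that `α = 2p/(D(D-1)) ≤ 1/d + 4/δ ≤ 1/d + ε/2`; no optimisation
in `N`), and Bézout's theorem is replaced throughout by the weak Bézout bound of
`PlaneCurveBezoutWeak` (any bound polynomial in the degrees suffices).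

## Structure of the proof (following §3 of the paper)

* `monSet`: the monomial sets `M_F(δ)` (monomials of degree in `[d, δ]` not divisible by the
  degree-lexicographic leading monomial of `F`), with `#M = d(δ-d+1)` (`card_monSet`),
  `∑ deg = d ∑_{h=d}^{δ} h` (`sum_deg_monSet`) and **Proposition 3**
  (`not_dvd_of_support_subset_monSet`: `F ∤ G` for `G ≠ 0` supported on `M_F(δ)`).
* `latticeCount_le_of_curves`: points per auxiliary curve (`≤ (d+δ)⁴`, weak Bézout).
* **Lemma 7** (`length_le_of_derivative_bounds`, Taylor's formula).
* **Lemma 6** in weak form (`exists_division_finset`, `piece_dichotomy`), from the level set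
  dichotomy `levelSet_dichotomy` of `BombieriPilaImplicitDerivatives` (implicit
  differentiation, the weak form of **Lemma 5**).
* Pieces of type (i) (`typeI_count`: integer translation into `[0, 2N]²`, the Generalized
  Main Lemma `generalizedMainLemma`, points per curve) and of type (ii) (`typeII_length`).
* The recursion `G(N) ≤ H N^α S_n + K₀^n` (`recursion`), the exponent bound `bpα_le`, the
  choice of `A` with `K₀ λ^α = 1/2` (`goodA`), and the final count
  (`bombieriPila_graph_card_le_holds`).

## References

* E. Bombieri, J. Pila, *The number of integral points on arcs and ovals*, Duke Math. J. 59
  (1989) 337–357, §3: Proposition 3, Lemmas 5–7, Theorem 4 [BombieriPila1989].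
-/

namespace Literature.NumberTheory.DiophantineGeometry.Dioph

open scoped ContDiff Topology
open MvPolynomial Filter Finset

/-! ### The monomial sets `M_F(δ)` and Proposition 3 -/

section Monomials

/-- The degree slice of `M_F(δ)`: monomials `x^a y^{h-a}` of degree `h` not divisible by
`x^{j₁} y^{j₂}` (`j₁ + j₂ ≤ h`), i.e. with `a < j₁` or `h - a < j₂`. [folklore] -/
def monSlice (jF : ℕ × ℕ) (h : ℕ) : Finset (ℕ × ℕ) :=
  (Finset.range jF.1).image (fun a => (a, h - a)) ∪ (Finset.range jF.2).image fun b => (h - b, b)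

/-- **Bombieri–Pila's monomial set `M_F(δ)`**: monomials of degree between `deg F` and `δ`
not divisible by the leading monomial `x^{j₁} y^{j₂}` of `F` (here: leading for the
degree-lexicographic order). [cite: BombieriPila1989, §3 (definition of `M_F(δ)`)] -/
def monSet (jF : ℕ × ℕ) (δ : ℕ) : Finset (ℕ × ℕ) :=
  (Finset.Icc (jF.1 + jF.2) δ).biUnion (monSlice jF)

variable {jF : ℕ × ℕ} {δ h : ℕ} {j : ℕ × ℕ}

/-- Elements of a degree slice have the prescribed degree and are not divisible by the leading
monomial. [folklore] -/
theorem mem_monSlice (hh : jF.1 + jF.2 ≤ h) (hj : j ∈ monSlice jF h) :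
    j.1 + j.2 = h ∧ ¬ (jF.1 ≤ j.1 ∧ jF.2 ≤ j.2) := by
  simp only [monSlice, Finset.mem_union, Finset.mem_image, Finset.mem_range] at hj
  rcases hj with ⟨a, ha, rfl⟩ | ⟨b, hb, rfl⟩
  · exact ⟨by simp; omega, by simp; omega⟩
  · exact ⟨by simp; omega, by simp; omega⟩

/-- Each degree slice of `M_F(δ)` has exactly `d = j₁ + j₂` elements. [folklore] -/
theorem card_monSlice (hh : jF.1 + jF.2 ≤ h) : (monSlice jF h).card = jF.1 + jF.2 := by
  rw [monSlice, Finset.card_union_of_disjoint, Finset.card_image_of_injective,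
    Finset.card_image_of_injective, Finset.card_range, Finset.card_range]
  · intro b b' hbb'
    simpa using congrArg Prod.snd hbb'
  · intro a a' haa'
    simpa using congrArg Prod.fst haa'
  · rw [Finset.disjoint_left]
    intro x hx hx'
    simp only [Finset.mem_image, Finset.mem_range] at hx hx'
    obtain ⟨a, ha, rfl⟩ := hx
    obtain ⟨b, hb, hab⟩ := hx'
    have := congrArg Prod.fst hab
    simp at this
    omega

/-- Elements of `M_F(δ)` have degree in `[d, δ]` and are not divisible by the leading monomial.
[folklore] -/
theorem mem_monSet (hj : j ∈ monSet jF δ) :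
    jF.1 + jF.2 ≤ j.1 + j.2 ∧ j.1 + j.2 ≤ δ ∧ ¬ (jF.1 ≤ j.1 ∧ jF.2 ≤ j.2) := by
  simp only [monSet, Finset.mem_biUnion, Finset.mem_Icc] at hj
  obtain ⟨h, ⟨hh1, hh2⟩, hjh⟩ := hj
  obtain ⟨hdeg, hndiv⟩ := mem_monSlice hh1 hjh
  exact ⟨hdeg ▸ hh1, hdeg ▸ hh2, hndiv⟩

/-- `#M_F(δ) = d (δ + 1 - d)`. [folklore] -/
theorem card_monSet :
    (monSet jF δ).card = (jF.1 + jF.2) * (δ + 1 - (jF.1 + jF.2)) := by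
  rw [monSet, Finset.card_biUnion]
  · rw [Finset.sum_congr rfl fun h hh => card_monSlice (Finset.mem_Icc.1 hh).1, Finset.sum_const,
      Nat.card_Icc, smul_eq_mul, mul_comm]
  · intro h hh h' hh' hne
    rw [Function.onFun, Finset.disjoint_left]
    intro x hx hx'
    have e1 := (mem_monSlice (Finset.mem_Icc.1 hh).1 hx).1
    have e2 := (mem_monSlice (Finset.mem_Icc.1 hh').1 hx').1
    exact hne (e1.symm.trans e2)

/-- The sum of the degrees of the monomials in `M_F(δ)` is `d ∑_{h=d}^{δ} h`. [folklore] -/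
theorem sum_deg_monSet :
    ∑ j ∈ monSet jF δ, (j.1 + j.2) = (jF.1 + jF.2) * ∑ h ∈ Finset.Icc (jF.1 + jF.2) δ, h := by
  rw [monSet, Finset.sum_biUnion]
  · rw [Finset.mul_sum]
    refine Finset.sum_congr rfl fun h hh => ?_
    have hh1 := (Finset.mem_Icc.1 hh).1
    rw [Finset.sum_congr rfl fun j hj => (mem_monSlice hh1 hj).1, Finset.sum_const, card_monSlice
      hh1,
      smul_eq_mul]
  · intro h hh h' hh' hne
    rw [Function.onFun, Finset.disjoint_left]
    intro x hx hx'
    have e1 := (mem_monSlice (Finset.mem_Icc.1 hh).1 hx).1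
    have e2 := (mem_monSlice (Finset.mem_Icc.1 hh').1 hx').1
    exact hne (e1.symm.trans e2)

/-- Twice the sum `∑_{h=d}^{δ} h`. [folklore] -/
theorem sum_Icc_mul_two (d δ : ℕ) (h : d ≤ δ) :
    (∑ h ∈ Finset.Icc d δ, h) * 2 = (δ + 1 - d) * (δ + d) := by
  induction δ with
  | zero =>
    have : d = 0 := by omega
    subst this; simp
  | succ δ ih =>
    rcases Nat.eq_or_lt_of_le h with rfl | hlt
    · simp [Finset.Icc_self]; ring
    · rw [Finset.sum_Icc_succ_top (by omega), add_mul, ih (by omega)]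
      have : δ + 1 + 1 - d = (δ + 1 - d) + 1 := by omega
      rw [this]
      have h2 : d ≤ δ := by omega
      zify [h2, (by omega : d ≤ δ + 1)]
      ring

/-- The leading exponent of `F` for the degree-lexicographic order. [folklore] -/
noncomputable def leadExp (F : MvPolynomial (Fin 2) ℝ) : ℕ × ℕ :=
  ((MonomialOrder.degLex.degree F) 0, (MonomialOrder.degLex.degree F) 1)

/-- The leading exponent has total degree `deg F`. [folklore] -/
theorem leadExp_sum (F : MvPolynomial (Fin 2) ℝ) : (leadExp F).1 + (leadExp F).2 = F.totalDegree
  := by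
  rw [leadExp, ← MvPolynomial.degree_degLexDegree (f := F), Finsupp.degree_eq_sum, Fin.sum_univ_two]

/-- **Bombieri–Pila, Proposition 3.** A nonzero `G` all of whose monomials lie in `M_F(δ)` is
not divisible by `F` (the leading monomial of `F · H` is divisible by that of `F`).
[cite: BombieriPila1989, Proposition 3] -/
theorem not_dvd_of_support_subset_monSet {F G : MvPolynomial (Fin 2) ℝ} (hG : G ≠ 0) (δ : ℕ)
    (hsupp : ∀ s ∈ G.support, (s 0, s 1) ∈ monSet (leadExp F) δ) : ¬ F ∣ G := by
  rintro ⟨H, rfl⟩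
  have hF : F ≠ 0 := left_ne_zero_of_mul hG
  have hH : H ≠ 0 := right_ne_zero_of_mul hG
  have hdeg := MonomialOrder.degree_mul (m := MonomialOrder.degLex) hF hH
  have hmem := MonomialOrder.degree_mem_support (m := MonomialOrder.degLex) hG
  have := (mem_monSet (hsupp _ hmem)).2.2
  apply this
  rw [hdeg]
  simp [leadExp]

end Monomials

/-! ### Counting lattice points on a graph over a closed interval -/

section Count

/-- The number of `m ∈ ℤ ∩ [u, v]` with `g(m) ∈ ℤ`. [folklore] -/
noncomputable def latticeCount (g : ℝ → ℝ) (u v : ℝ) : ℕ :=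
  open scoped Classical in ((Finset.Icc ⌈u⌉ ⌊v⌋).filter fun m : ℤ => ∃ n : ℤ, g m = n).card

open scoped Classical in
/-- Membership in the finite set underlying `latticeCount`. [folklore] -/
theorem mem_latticeCount_set {g : ℝ → ℝ} {u v : ℝ} {m : ℤ} :
    m ∈ (Finset.Icc ⌈u⌉ ⌊v⌋).filter (fun m : ℤ => ∃ n : ℤ, g m = n) ↔
      (u ≤ m ∧ (m : ℝ) ≤ v) ∧ ∃ n : ℤ, g m = n := by
  rw [Finset.mem_filter, Finset.mem_Icc, Int.ceil_le, Int.le_floor]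

/-- An interval of length `< 1` contains at most one lattice point. [folklore] -/
theorem latticeCount_le_one {g : ℝ → ℝ} {u v : ℝ} (h : v - u < 1) : latticeCount g u v ≤ 1 := by
  classical
  unfold latticeCount
  refine (Finset.card_filter_le _ _).trans ?_
  rw [Int.card_Icc]
  have : ⌊v⌋ + 1 - ⌈u⌉ ≤ 1 := by
    have h1 : (⌊v⌋ : ℝ) ≤ v := Int.floor_le v
    have h2 : u ≤ (⌈u⌉ : ℝ) := Int.le_ceil u
    have h3 : ((⌊v⌋ - ⌈u⌉ : ℤ) : ℝ) < 1 := by push_cast; linarith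
    have h4 : ⌊v⌋ - ⌈u⌉ < 1 := by exact_mod_cast h3
    omega
  exact (Int.toNat_le_toNat this).trans (by simp)

/-- Trivial bound: `latticeCount g u v ≤ v - u + 1`. [folklore] -/
theorem latticeCount_le_length {g : ℝ → ℝ} {u v : ℝ} (huv : u ≤ v) :
    (latticeCount g u v : ℝ) ≤ v - u + 1 := by
  classical
  unfold latticeCount
  have h0 : (((Finset.Icc ⌈u⌉ ⌊v⌋).filter fun m : ℤ => ∃ n : ℤ, g m = n).card : ℝ) ≤
      ((Finset.Icc ⌈u⌉ ⌊v⌋).card : ℝ) := by exact_mod_cast Finset.card_filter_le _ _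
  refine h0.trans ?_
  rw [Int.card_Icc]
  have h1 : (⌊v⌋ : ℝ) ≤ v := Int.floor_le v
  have h2 : u ≤ (⌈u⌉ : ℝ) := Int.le_ceil u
  rcases le_or_gt 0 (⌊v⌋ + 1 - ⌈u⌉) with hle | hlt
  · have : (((⌊v⌋ + 1 - ⌈u⌉).toNat : ℕ) : ℝ) = ((⌊v⌋ + 1 - ⌈u⌉ : ℤ) : ℝ) := by
      rw [← Int.cast_natCast, Int.toNat_of_nonneg hle]
    rw [this]
    push_cast
    linarith
  · rw [Int.toNat_eq_zero.2 hlt.le]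
    simp only [Nat.cast_zero]
    linarith

end Count

/-! ### Lemma 7: intervals on which a high derivative is large are short -/

section Lemma7

/-- **Bombieri–Pila, Lemma 7** (Taylor's formula). Let `g` be smooth near `[u, v]`,
`|g(v) - g(u)| ≤ N`, `|g^{(i)}| ≤ i! B^i N^{1-i}` on `[u, v]` for `1 ≤ i < k` and
`|g^{(k)}| ≥ k! B^k N^{1-k}` on `[u, v]` (`k ≥ 1`, `B > 0`). Then `v - u ≤ 2N/B`.
(The paper assumes `|g| ≤ N` and states `|I| ≤ 2 A^{-1/k} N` with `B = A^{1/k}`.)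
[cite: BombieriPila1989, Lemma 7] -/
theorem length_le_of_derivative_bounds {g : ℝ → ℝ} {J : Set ℝ} (hJ : IsOpen J)
    (hg : ContDiffOn ℝ ∞ g J) {u v : ℝ} (huv : u < v) (hsub : Set.Icc u v ⊆ J)
    {N B : ℝ} (hN : 0 < N) (hB : 0 < B) {k : ℕ} (hk : 1 ≤ k)
    (hdiff : |g v - g u| ≤ N)
    (hsmall : ∀ i : ℕ, 1 ≤ i → i < k → |iteratedDeriv i g u| ≤ i.factorial * B ^ i * (N / N ^ i))
    (hlarge : ∀ x ∈ Set.Icc u v, k.factorial * B ^ k * (N / N ^ k) ≤ |iteratedDeriv k g x|) :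
    v - u ≤ 2 * N / B := by
  obtain ⟨k', rfl⟩ : ∃ k', k = k' + 1 := ⟨k - 1, by omega⟩
  set h := v - u with hh
  have hh0 : 0 < h := by rw [hh]; linarith
  -- Taylor with Lagrange remainder
  have hcd : ContDiffOn ℝ (k' + 1) g (Set.uIcc u v) := by
    rw [Set.uIcc_of_le huv.le]
    exact (hg.of_le (by exact_mod_cast le_top)).mono hsub
  obtain ⟨ξ, hξ, htaylor⟩ := taylor_mean_remainder_lagrange_iteratedDeriv huv.ne hcd
  rw [Set.uIoo_of_le huv.le] at hξ
  have hξI : ξ ∈ Set.Icc u v := ⟨hξ.1.le, hξ.2.le⟩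
  -- the Taylor polynomial in terms of `iteratedDeriv`
  have hT : taylorWithinEval g k' (Set.uIcc u v) u v =
      ∑ i ∈ Finset.range (k' + 1), ((i.factorial : ℝ)⁻¹ * h ^ i) * iteratedDeriv i g u := by
    rw [taylor_within_apply]
    refine Finset.sum_congr rfl fun i _ => ?_
    rw [smul_eq_mul, hh]
    congr 1
    rw [Set.uIcc_of_le huv.le]
    exact iteratedDerivWithin_eq_iteratedDeriv (uniqueDiffOn_Icc huv)
      ((hg.contDiffAt (hJ.mem_nhds (hsub (Set.left_mem_Icc.2 huv.le)))).of_le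
        (by exact_mod_cast le_top)) (Set.left_mem_Icc.2 huv.le)
  -- split off the constant term
  rw [hT, Finset.sum_range_succ'] at htaylor
  simp only [Nat.factorial_zero, Nat.cast_one, inv_one, pow_zero, mul_one, iteratedDeriv_zero,
    one_mul] at htaylor
  -- htaylor : g v - (∑ i < k', term (i+1) + g u) = g^{(k'+1)}(ξ) h^{k'+1}/(k'+1)!
  have hrem : |iteratedDeriv (k' + 1) g ξ| * h ^ (k' + 1) / (k' + 1).factorial ≤
      N + ∑ i ∈ Finset.range k', B ^ (i + 1) * (N / N ^ (i + 1)) * h ^ (i + 1) := by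
    have e : iteratedDeriv (k' + 1) g ξ * (v - u) ^ (k' + 1) / (k' + 1).factorial =
        (g v - g u) - ∑ i ∈ Finset.range k', ((((i + 1).factorial : ℝ))⁻¹ * h ^ (i + 1)) *
          iteratedDeriv (i + 1) g u := by
      rw [← htaylor]; ring
    rw [← hh] at e
    have : |iteratedDeriv (k' + 1) g ξ| * h ^ (k' + 1) / (k' + 1).factorial =
        |iteratedDeriv (k' + 1) g ξ * h ^ (k' + 1) / (k' + 1).factorial| := by
      rw [abs_div, abs_mul, abs_of_pos (pow_pos hh0 _), Nat.abs_cast]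
    rw [this, e]
    refine (abs_sub _ _).trans (add_le_add hdiff ?_)
    refine (Finset.abs_sum_le_sum_abs _ _).trans (Finset.sum_le_sum fun i hi => ?_)
    have hi' : i + 1 < k' + 1 := by have := Finset.mem_range.1 hi; omega
    have hs := hsmall (i + 1) (by omega) hi'
    rw [abs_mul, abs_mul, abs_inv, Nat.abs_cast, abs_of_pos (pow_pos hh0 _)]
    have hfpos : (0 : ℝ) < (i + 1).factorial := by positivity
    calc ((i + 1).factorial : ℝ)⁻¹ * h ^ (i + 1) * |iteratedDeriv (i + 1) g u|
        ≤ ((i + 1).factorial : ℝ)⁻¹ * h ^ (i + 1) *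
          ((i + 1).factorial * B ^ (i + 1) * (N / N ^ (i + 1))) := by gcongr
      _ = B ^ (i + 1) * (N / N ^ (i + 1)) * h ^ (i + 1) := by field_simp
  -- lower bound for the remainder
  have hlow : (k' + 1).factorial * B ^ (k' + 1) * (N / N ^ (k' + 1)) * h ^ (k' + 1) /
      (k' + 1).factorial ≤ |iteratedDeriv (k' + 1) g ξ| * h ^ (k' + 1) / (k' + 1).factorial := by
    have := hlarge ξ hξI
    gcongr
  have hkey : B ^ (k' + 1) * (N / N ^ (k' + 1)) * h ^ (k' + 1) ≤
      N + ∑ i ∈ Finset.range k', B ^ (i + 1) * (N / N ^ (i + 1)) * h ^ (i + 1) := by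
    have e : (k' + 1).factorial * B ^ (k' + 1) * (N / N ^ (k' + 1)) * h ^ (k' + 1) /
        (k' + 1).factorial = B ^ (k' + 1) * (N / N ^ (k' + 1)) * h ^ (k' + 1) := by
      field_simp
    rw [← e]
    exact hlow.trans hrem
  -- in terms of `μ = B h / N`
  set μ := B * h / N with hμ
  have hμ0 : 0 < μ := by positivity
  have hterm : ∀ i : ℕ, B ^ i * (N / N ^ i) * h ^ i = N * μ ^ i := by
    intro i
    rw [hμ, div_pow, mul_pow]
    field_simp
  simp only [hterm] at hkey
  have hgeom : μ ^ (k' + 1) ≤ ∑ i ∈ Finset.range (k' + 1), μ ^ i := by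
    rw [Finset.sum_range_succ']
    simp only [pow_zero]
    have : N * μ ^ (k' + 1) ≤ N * (∑ i ∈ Finset.range k', μ ^ (i + 1) + 1) := by
      rw [mul_add, mul_one, Finset.mul_sum]
      linarith
    exact le_of_mul_le_mul_left this hN
  -- hence `μ ≤ 2`
  have hμ2 : μ ≤ 2 := by
    by_contra hcon
    push Not at hcon
    have hg1 : 1 < μ - 1 := by linarith
    have hS : 0 < ∑ i ∈ Finset.range (k' + 1), μ ^ i :=
      Finset.sum_pos (fun i _ => pow_pos hμ0 i) ⟨0, by simp⟩
    have := geom_sum_mul μ (k' + 1)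
    -- (∑ μ^i) * (μ - 1) = μ^(k'+1) - 1
    nlinarith
  rw [hμ] at hμ2
  rw [div_le_iff₀ hN] at hμ2
  rw [le_div_iff₀ hB]
  linarith

end Lemma7

/-! ### Subdivision of an interval -/

section Subdivision

/-- **Threshold dichotomy.** A continuous function on `(p, q)` avoiding the values `±A` there
(or identically `±A` on a larger interval) satisfies `|φ| ≤ A` on `[p, q]` or `|φ| ≥ A` on
`[p, q]` (intermediate value theorem and closure). [folklore] -/
theorem abs_le_or_le_abs {φ : ℝ → ℝ} {a b p q A : ℝ} (hφ : ContinuousOn φ (Set.Ioo a b))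
    (hpq : p < q) (hsub : Set.Icc p q ⊆ Set.Ioo a b)
    (hplus : (∀ x ∈ Set.Ioo a b, φ x = A) ∨ ∀ x ∈ Set.Ioo p q, φ x ≠ A)
    (hminus : (∀ x ∈ Set.Ioo a b, φ x = -A) ∨ ∀ x ∈ Set.Ioo p q, φ x ≠ -A) :
    (∀ x ∈ Set.Icc p q, |φ x| ≤ A) ∨ (∀ x ∈ Set.Icc p q, A ≤ |φ x|) := by
  rcases hplus with h | hneP
  · right; intro x hx; rw [h x (hsub hx)]; exact le_abs_self A
  rcases hminus with h | hneM
  · right; intro x hx; rw [h x (hsub hx), abs_neg]; exact le_abs_self A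
  have hIoo : Set.Ioo p q ⊆ Set.Ioo a b := Set.Ioo_subset_Icc_self.trans hsub
  have hcont : ContinuousOn φ (Set.Ioo p q) := hφ.mono hIoo
  have hcontI : ContinuousOn (fun x => |φ x|) (Set.Icc p q) :=
    (continuous_abs.comp_continuousOn (hφ.mono hsub))
  -- dichotomy on the open interval
  have hopen : (∀ x ∈ Set.Ioo p q, |φ x| ≤ A) ∨ (∀ x ∈ Set.Ioo p q, A ≤ |φ x|) := by
    by_contra hcon
    rw [not_or] at hcon
    obtain ⟨h1, h2⟩ := hcon
    push Not at h1 h2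
    obtain ⟨x₁, hx₁, hgt⟩ := h1
    obtain ⟨x₂, hx₂, hlt⟩ := h2
    rw [abs_lt] at hlt
    rcases lt_abs.1 hgt with hpos | hneg
    · have hmem : A ∈ Set.Icc (φ x₂) (φ x₁) := ⟨hlt.2.le, hpos.le⟩
      obtain ⟨x, hx, hxA⟩ := isPreconnected_Ioo.intermediate_value hx₂ hx₁ hcont hmem
      exact hneP x hx hxA
    · have hmem : -A ∈ Set.Icc (φ x₁) (φ x₂) := ⟨by linarith, hlt.1.le⟩
      obtain ⟨x, hx, hxA⟩ := isPreconnected_Ioo.intermediate_value hx₁ hx₂ hcont hmem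
      exact hneM x hx hxA
  -- pass to the closed interval
  have hcl : closure (Set.Ioo p q) = Set.Icc p q := closure_Ioo hpq.ne
  rcases hopen with h | h
  · left
    have hK : IsClosed (Set.Icc p q ∩ (fun x => |φ x|) ⁻¹' Set.Iic A) :=
      hcontI.preimage_isClosed_of_isClosed isClosed_Icc isClosed_Iic
    have hsubK : Set.Ioo p q ⊆ Set.Icc p q ∩ (fun x => |φ x|) ⁻¹' Set.Iic A :=
      fun x hx => ⟨Set.Ioo_subset_Icc_self hx, h x hx⟩
    have := closure_minimal hsubK hK
    rw [hcl] at this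
    exact fun x hx => (this hx).2
  · right
    have hK : IsClosed (Set.Icc p q ∩ (fun x => |φ x|) ⁻¹' Set.Ici A) :=
      hcontI.preimage_isClosed_of_isClosed isClosed_Icc isClosed_Ici
    have hsubK : Set.Ioo p q ⊆ Set.Icc p q ∩ (fun x => |φ x|) ⁻¹' Set.Ici A :=
      fun x hx => ⟨Set.Ioo_subset_Icc_self hx, h x hx⟩
    have := closure_minimal hsubK hK
    rw [hcl] at this
    exact fun x hx => (this hx).2

/-- **Consecutive points of a finite set.** Every point of `[u, v]` (`u < v` in `T`) lies in
`[p, q]` for some consecutive `p < q` in `T`. [folklore] -/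
theorem exists_consecutive {T : Finset ℝ} {u v x : ℝ} (hu : u ∈ T) (hv : v ∈ T) (huv : u < v)
    (hx : x ∈ Set.Icc u v) :
    ∃ pq ∈ (T ×ˢ T).filter (fun pq : ℝ × ℝ => pq.1 < pq.2 ∧ ∀ t ∈ T, ¬ (pq.1 < t ∧ t < pq.2)),
      x ∈ Set.Icc pq.1 pq.2 := by
  rcases lt_or_eq_of_le hx.2 with hxv | rfl
  · have hlo : u ∈ T.filter (· ≤ x) := Finset.mem_filter.2 ⟨hu, hx.1⟩
    have hhi : v ∈ T.filter (x < ·) := Finset.mem_filter.2 ⟨hv, hxv⟩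
    set p₀ := (T.filter (· ≤ x)).max' ⟨_, hlo⟩ with hp₀
    set q₀ := (T.filter (x < ·)).min' ⟨_, hhi⟩ with hq₀
    have hp : p₀ ∈ T ∧ p₀ ≤ x := Finset.mem_filter.1 (Finset.max'_mem _ ⟨_, hlo⟩)
    have hq : q₀ ∈ T ∧ x < q₀ := Finset.mem_filter.1 (Finset.min'_mem _ ⟨_, hhi⟩)
    refine ⟨(p₀, q₀), Finset.mem_filter.2 ⟨Finset.mem_product.2 ⟨hp.1, hq.1⟩,
      hp.2.trans_lt hq.2, ?_⟩, hp.2, hq.2.le⟩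
    intro t ht ⟨h1, h2⟩
    rcases le_or_gt t x with htx | hxt
    · have := Finset.le_max' (T.filter (· ≤ x)) t (Finset.mem_filter.2 ⟨ht, htx⟩); linarith
    · have := Finset.min'_le (T.filter (x < ·)) t (Finset.mem_filter.2 ⟨ht, hxt⟩); linarith
  · have hlo : u ∈ T.filter (· < x) := Finset.mem_filter.2 ⟨hu, huv⟩
    set p₀ := (T.filter (· < x)).max' ⟨_, hlo⟩ with hp₀
    have hp : p₀ ∈ T ∧ p₀ < x := Finset.mem_filter.1 (Finset.max'_mem _ ⟨_, hlo⟩)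
    refine ⟨(p₀, x), Finset.mem_filter.2 ⟨Finset.mem_product.2 ⟨hp.1, hv⟩, hp.2, ?_⟩,
      hp.2.le, le_rfl⟩
    intro t ht ⟨h1, h2⟩
    have := Finset.le_max' (T.filter (· < x)) t (Finset.mem_filter.2 ⟨ht, h2⟩)
    linarith

/-- **Subadditivity of the count** over a cover by consecutive pieces. [folklore] -/
theorem latticeCount_le_sum {g : ℝ → ℝ} {T : Finset ℝ} {u v : ℝ} (hu : u ∈ T) (hv : v ∈ T)
    (huv : u < v) :
    latticeCount g u v ≤ ∑ pq ∈ (T ×ˢ T).filter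
      (fun pq : ℝ × ℝ => pq.1 < pq.2 ∧ ∀ t ∈ T, ¬ (pq.1 < t ∧ t < pq.2)),
        latticeCount g pq.1 pq.2 := by
  classical
  unfold latticeCount
  set CP := (T ×ˢ T).filter (fun pq : ℝ × ℝ => pq.1 < pq.2 ∧ ∀ t ∈ T, ¬ (pq.1 < t ∧ t < pq.2))
  have hsub : ((Finset.Icc ⌈u⌉ ⌊v⌋).filter fun m : ℤ => ∃ n : ℤ, g m = n) ⊆
      CP.biUnion fun pq => (Finset.Icc ⌈pq.1⌉ ⌊pq.2⌋).filter fun m : ℤ => ∃ n : ℤ, g m = n := by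
    intro m hm
    rw [mem_latticeCount_set] at hm
    obtain ⟨⟨h1, h2⟩, hn⟩ := hm
    obtain ⟨pq, hpq, hmpq⟩ := exists_consecutive hu hv huv ⟨h1, h2⟩
    exact Finset.mem_biUnion.2 ⟨pq, hpq, mem_latticeCount_set.2 ⟨⟨hmpq.1, hmpq.2⟩, hn⟩⟩
  exact (Finset.card_le_card hsub).trans Finset.card_biUnion_le

end Subdivision

/-! ### Points per auxiliary curve -/

section Curves

/-- The polynomial with coefficient vector `c` on the monomial set `M`. [folklore] -/
noncomputable def curvePoly (M : Finset (ℕ × ℕ)) (c : ℕ × ℕ → ℝ) : MvPolynomial (Fin 2) ℝ :=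
  ∑ j ∈ M, monomial (Finsupp.single 0 j.1 + Finsupp.single 1 j.2) (c j)

/-- Evaluating the polynomial with coefficient vector `c` on `M`. [folklore] -/
theorem eval_curvePoly (M : Finset (ℕ × ℕ)) (c : ℕ × ℕ → ℝ) (x y : ℝ) :
    MvPolynomial.eval ![x, y] (curvePoly M c) = ∑ j ∈ M, c j * x ^ j.1 * y ^ j.2 := by
  rw [curvePoly, map_sum]
  refine Finset.sum_congr rfl fun j _ => ?_
  rw [eval_monomial, Finsupp.prod_add_index' (fun _ => pow_zero _) (fun _ _ _ => pow_add _ _ _)]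
  have h0 : ((Finsupp.single (0 : Fin 2) j.1).prod fun i e => (![x, y] : Fin 2 → ℝ) i ^ e) =
      x ^ j.1 := by
    rw [Finsupp.prod_single_index (h := fun i e => (![x, y] : Fin 2 → ℝ) i ^ e) (pow_zero _)]
    rfl
  have h1 : ((Finsupp.single (1 : Fin 2) j.2).prod fun i e => (![x, y] : Fin 2 → ℝ) i ^ e) =
      y ^ j.2 := by
    rw [Finsupp.prod_single_index (h := fun i e => (![x, y] : Fin 2 → ℝ) i ^ e) (pow_zero _)]
    rfl
  rw [h0, h1, mul_assoc]

/-- The coefficients of `curvePoly M c` are the `c j`. [folklore] -/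
theorem coeff_curvePoly (M : Finset (ℕ × ℕ)) (c : ℕ × ℕ → ℝ) (j₀ : ℕ × ℕ) (hj₀ : j₀ ∈ M) :
    (curvePoly M c).coeff (Finsupp.single 0 j₀.1 + Finsupp.single 1 j₀.2) = c j₀ := by
  rw [curvePoly, coeff_sum]
  rw [Finset.sum_eq_single j₀]
  · rw [coeff_monomial, if_pos rfl]
  · intro j _ hne
    rw [coeff_monomial, if_neg]
    intro h
    rw [single_add_single_inj] at h
    exact hne (Prod.ext h.1 h.2)
  · intro h; exact absurd hj₀ h

/-- `curvePoly M c` is supported on the monomials of `M`. [folklore] -/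
theorem support_curvePoly {M : Finset (ℕ × ℕ)} {c : ℕ × ℕ → ℝ} {s : Fin 2 →₀ ℕ}
    (hs : s ∈ (curvePoly M c).support) : (s 0, s 1) ∈ M := by
  classical
  rw [mem_support_iff, curvePoly, coeff_sum] at hs
  obtain ⟨j, hj, hne⟩ := Finset.exists_ne_zero_of_sum_ne_zero hs
  rw [coeff_monomial] at hne
  split_ifs at hne with h
  · rw [← h]
    simpa [Finsupp.add_apply, Finsupp.single_apply] using hj
  · exact absurd rfl hne

/-- The degree of `curvePoly M c` is at most the largest degree in `M`. [folklore] -/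
theorem totalDegree_curvePoly_le {M : Finset (ℕ × ℕ)} {c : ℕ × ℕ → ℝ} {δ : ℕ}
    (hM : ∀ j ∈ M, j.1 + j.2 ≤ δ) : (curvePoly M c).totalDegree ≤ δ := by
  rw [curvePoly]
  refine totalDegree_finsetSum_le fun j hj => (totalDegree_monomial_le _ _).trans ?_
  refine le_of_eq_of_le ?_ (hM j hj)
  have := sum_single_add_single j.1 j.2
  exact this

/-- **Points per curve.** If the lattice points of `g` over `[u, v]` lie on the curve `F = 0`
(`F` irreducible of degree `d`) and each of them lies on one of `n` curves `G_i = 0` with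
`G_i ≠ 0` supported on `M_F(δ)` (degree `≤ δ`), then there are at most `n (d + δ)⁴` of them
(Proposition 3 and weak Bézout). [cite: BombieriPila1989, Proposition 3] -/
theorem latticeCount_le_of_curves {F : MvPolynomial (Fin 2) ℝ} (hF : Irreducible F) {δ : ℕ}
    {g : ℝ → ℝ} {u v : ℝ} {n : ℕ} {c : Fin n → ℕ × ℕ → ℝ}
    (hc0 : ∀ i, ∃ j ∈ monSet (leadExp F) δ, c i j ≠ 0)
    (hrel : ∀ m n' : ℤ, (m : ℝ) ∈ Set.Icc u v → g m = n' →
      ∃ i, ∑ j ∈ monSet (leadExp F) δ, c i j * (m : ℝ) ^ j.1 * (n' : ℝ) ^ j.2 = 0)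
    (hcurve : ∀ m n' : ℤ, (m : ℝ) ∈ Set.Icc u v → g m = n' →
      MvPolynomial.eval ![(m : ℝ), (n' : ℝ)] F = 0) :
    latticeCount g u v ≤ n * (F.totalDegree + δ) ^ 4 := by
  classical
  set M := monSet (leadExp F) δ with hMdef
  set G : Fin n → MvPolynomial (Fin 2) ℝ := fun i => curvePoly M (c i) with hG
  have hG0 : ∀ i, G i ≠ 0 := by
    intro i hi
    obtain ⟨j, hj, hcj⟩ := hc0 i
    apply hcj
    rw [← coeff_curvePoly M (c i) j hj]
    have : curvePoly M (c i) = G i := rfl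
    rw [this, hi, coeff_zero]
  have hndvd : ∀ i, ¬ F ∣ G i := fun i =>
    not_dvd_of_support_subset_monSet (hG0 i) δ fun s hs => support_curvePoly hs
  have hdegG : ∀ i, (G i).totalDegree ≤ δ := fun i =>
    totalDegree_curvePoly_le fun j hj => (mem_monSet hj).2.1
  have hZ : ∀ i, {pt : ℝ × ℝ | MvPolynomial.eval ![pt.1, pt.2] F = 0 ∧
      MvPolynomial.eval ![pt.1, pt.2] (G i) = 0}.Finite ∧
      {pt : ℝ × ℝ | MvPolynomial.eval ![pt.1, pt.2] F = 0 ∧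
        MvPolynomial.eval ![pt.1, pt.2] (G i) = 0}.ncard ≤ (F.totalDegree + δ) ^ 4 := by
    intro i
    obtain ⟨hfin, hcard⟩ := mv_commonZeros_finite_ncard_le hF (hndvd i)
    exact ⟨hfin, hcard.trans (Nat.pow_le_pow_left (by have := hdegG i; omega) 4)⟩
  -- the count set maps injectively into the union of the zero sets
  unfold latticeCount
  set S := (Finset.Icc ⌈u⌉ ⌊v⌋).filter fun m : ℤ => ∃ n' : ℤ, g m = n' with hS
  set Zf : Fin n → Finset (ℝ × ℝ) := fun i => (hZ i).1.toFinset with hZf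
  have hcardZ : ∀ i, (Zf i).card ≤ (F.totalDegree + δ) ^ 4 := fun i => by
    rw [hZf, ← Set.ncard_eq_toFinset_card _ (hZ i).1]
    exact (hZ i).2
  have hmaps : ∀ m ∈ S, ((m : ℝ), g m) ∈ Finset.univ.biUnion Zf := by
    intro m hm
    rw [hS, mem_latticeCount_set] at hm
    obtain ⟨hmI, n', hn'⟩ := hm
    obtain ⟨i, hi⟩ := hrel m n' hmI hn'
    refine Finset.mem_biUnion.2 ⟨i, Finset.mem_univ _, (hZ i).1.mem_toFinset.2 ⟨?_, ?_⟩⟩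
    · simp only; rw [hn']; exact hcurve m n' hmI hn'
    · simp only; rw [hn', hG]; simp only; rw [eval_curvePoly]; exact hi
  calc S.card ≤ (Finset.univ.biUnion Zf).card :=
        Finset.card_le_card_of_injOn (fun m => ((m : ℝ), g m)) hmaps (by
          intro m _ m' _ h
          simpa using congrArg Prod.fst h)
    _ ≤ ∑ i, (Zf i).card := Finset.card_biUnion_le
    _ ≤ ∑ _i : Fin n, (F.totalDegree + δ) ^ 4 := Finset.sum_le_sum fun i _ => hcardZ i
    _ = n * (F.totalDegree + δ) ^ 4 := by simp

end Curves

/-! ### The bound for pieces of type (i) -/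

section TypeI

/-- Simplification of `W` (Lemma 4) when all monomials have positive degree and `A ≥ 1`,
`N ≥ 1`: `W ≤ D! D^{p-D} A^p · N^p / N^{D(D-1)/2}`. [folklore] -/
theorem gmlW_le (M : Finset (ℕ × ℕ)) (hM1 : ∀ j ∈ M, 1 ≤ j.1 + j.2) {N A : ℝ} (hN : 1 ≤ N)
    (hA : 1 ≤ A) :
    gmlW M N A ≤ (M.card.factorial : ℝ) * (M.card : ℝ) ^ (∑ j ∈ M, (j.1 + j.2) - M.card) *
      A ^ (∑ j ∈ M, (j.1 + j.2)) *
        (N ^ (∑ j ∈ M, (j.1 + j.2)) / N ^ (M.card * (M.card - 1) / 2)) := by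
  set D := M.card with hD
  set p := ∑ j ∈ M, (j.1 + j.2) with hp
  have hN0 : 0 < N := by linarith
  have hpD : D ≤ p := by
    rw [hp, hD, Finset.card_eq_sum_ones]
    exact Finset.sum_le_sum fun j hj => hM1 j hj
  have h1 : ∏ m ∈ Finset.range D, N / N ^ m = N ^ D / N ^ (D * (D - 1) / 2) := by
    rw [Finset.prod_div_distrib, Finset.prod_const, Finset.card_range, Finset.prod_pow_eq_pow_sum,
      Finset.sum_range_id]
  have h2 : ∏ j ∈ M, (((D : ℝ) * N) ^ (j.1 + j.2 - 1) * A ^ j.2) ≤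
      ∏ j ∈ M, (((D : ℝ) * N) ^ (j.1 + j.2 - 1) * A ^ (j.1 + j.2)) := by
    refine Finset.prod_le_prod (fun j _ => by positivity) fun j _ => ?_
    exact mul_le_mul_of_nonneg_left (pow_le_pow_right₀ hA (Nat.le_add_left _ _)) (by positivity)
  have h3 : ∏ j ∈ M, (((D : ℝ) * N) ^ (j.1 + j.2 - 1) * A ^ (j.1 + j.2)) =
      ((D : ℝ) * N) ^ (p - D) * A ^ p := by
    rw [Finset.prod_mul_distrib, Finset.prod_pow_eq_pow_sum, Finset.prod_pow_eq_pow_sum, ← hp]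
    congr 1
    rw [Finset.sum_tsub_distrib _ fun j hj => hM1 j hj, ← hp, ← Finset.card_eq_sum_ones, ← hD]
  unfold gmlW
  rw [← hD, h1]
  calc (D.factorial : ℝ) * (N ^ D / N ^ (D * (D - 1) / 2)) *
        ∏ j ∈ M, (((D : ℝ) * N) ^ (j.1 + j.2 - 1) * A ^ j.2)
      ≤ (D.factorial : ℝ) * (N ^ D / N ^ (D * (D - 1) / 2)) *
          (((D : ℝ) * N) ^ (p - D) * A ^ p) := by
        rw [← h3]
        gcongr
    _ = (D.factorial : ℝ) * (D : ℝ) ^ (p - D) * A ^ p * (N ^ p / N ^ (D * (D - 1) / 2)) := by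
        rw [mul_pow]
        have : (N : ℝ) ^ p = N ^ D * N ^ (p - D) := by rw [← pow_add, Nat.add_sub_cancel' hpD]
        rw [this]
        ring

/-- The count of curves `N · W^{2/(D(D-1))}` in terms of `N^α`, `α = 2p/(D(D-1))`:
`N · W^{2/(D(D-1))} ≤ W₁^{1/E} N^{p/E}` with `E = D(D-1)/2`, `W₁ = D! D^{p-D} A^p`.
[folklore] -/
theorem curveCount_le (M : Finset (ℕ × ℕ)) (hM1 : ∀ j ∈ M, 1 ≤ j.1 + j.2) (hD : 2 ≤ M.card)
    {N A : ℝ} (hN : 1 ≤ N) (hA : 1 ≤ A) :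
    N * gmlW M N A ^ (2 / ((M.card : ℝ) * (M.card - 1 : ℕ))) ≤
      ((M.card.factorial : ℝ) * (M.card : ℝ) ^ (∑ j ∈ M, (j.1 + j.2) - M.card) *
        A ^ (∑ j ∈ M, (j.1 + j.2))) ^ (1 / ((M.card * (M.card - 1) / 2 : ℕ) : ℝ)) *
      N ^ ((∑ j ∈ M, (j.1 + j.2) : ℕ) / ((M.card * (M.card - 1) / 2 : ℕ) : ℝ)) := by
  set D := M.card with hDdef
  set p := ∑ j ∈ M, (j.1 + j.2) with hp
  set E := D * (D - 1) / 2 with hE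
  set W₁ := (D.factorial : ℝ) * (D : ℝ) ^ (p - D) * A ^ p with hW₁def
  have hN0 : 0 < N := by linarith
  have hEreal : ((E : ℕ) : ℝ) = (D : ℝ) * (D - 1 : ℕ) / 2 := cast_choose_two D
  have hE1 : 1 ≤ E := by
    rw [hE, Nat.le_div_iff_mul_le (by norm_num)]
    have : 1 ≤ D - 1 := by omega
    nlinarith
  have hEpos : (0 : ℝ) < E := by exact_mod_cast hE1
  have hexp : 2 / ((D : ℝ) * (D - 1 : ℕ)) = 1 / (E : ℝ) := by
    rw [hEreal]
    have : (0 : ℝ) < (D : ℝ) * (D - 1 : ℕ) := by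
      have := hEpos; rw [hEreal] at this; linarith
    field_simp
  rw [hexp]
  have hW : 0 < gmlW M N A := gmlW_pos M hN0 (by linarith)
  have hW₁ : 0 < W₁ := by positivity
  have hle := gmlW_le M hM1 hN hA
  rw [← hDdef, ← hp, ← hW₁def, ← hE] at hle
  have e0 : 0 ≤ 1 / (E : ℝ) := by positivity
  calc N * gmlW M N A ^ (1 / (E : ℝ))
      ≤ N * (W₁ * (N ^ p / N ^ E)) ^ (1 / (E : ℝ)) := by
        gcongr
    _ = W₁ ^ (1 / (E : ℝ)) * (N * (N ^ p / N ^ E) ^ (1 / (E : ℝ))) := by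
        rw [Real.mul_rpow hW₁.le (by positivity)]; ring
    _ = W₁ ^ (1 / (E : ℝ)) * N ^ ((p : ℝ) / E) := by
        congr 1
        rw [show (N : ℝ) ^ p / N ^ E = N ^ ((p : ℝ) - E) by
          rw [Real.rpow_sub hN0, Real.rpow_natCast, Real.rpow_natCast]]
        rw [← Real.rpow_mul hN0.le]
        rw [show ((p : ℝ) - E) * (1 / E) = (p : ℝ) / E - 1 by field_simp]
        rw [Real.rpow_sub hN0, Real.rpow_one]
        field_simp

end TypeI

section TypeIPiece

/-- The lattice count is monotone under restriction of integral translates: counting `g` on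
`[p, q]` is counting `x ↦ g(x + m₀) - n₀` on `[p - m₀, q - m₀]`. [folklore] -/
theorem latticeCount_translate (g : ℝ → ℝ) (p q : ℝ) (m₀ n₀ : ℤ) :
    latticeCount g p q ≤ latticeCount (fun x => g (x + m₀) - n₀) (p - m₀) (q - m₀) := by
  classical
  unfold latticeCount
  refine Finset.card_le_card_of_injOn (fun m => m - m₀) ?_ ?_
  · intro m hm
    obtain ⟨⟨h1, h2⟩, n', hn'⟩ := mem_latticeCount_set.1 (Finset.mem_coe.1 hm)
    dsimp only
    refine Finset.mem_coe.2 ((mem_latticeCount_set (g := fun x => g (x + ↑m₀) - ↑n₀)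
      (u := p - m₀) (v := q - m₀) (m := m - m₀)).2 ⟨⟨?_, ?_⟩, n' - n₀, ?_⟩)
    · push_cast; linarith
    · push_cast; linarith
    · show g (((m - m₀ : ℤ) : ℝ) + m₀) - n₀ = ((n' - n₀ : ℤ) : ℝ)
      push_cast
      rw [sub_add_cancel, hn']
  · intro m _ m' _ h
    simpa using h

/-- `D = d(δ - d + 1)`, the number of monomials in `M_F(δ)`. [cite: BombieriPila1989, §3] -/
def bpD (d δ : ℕ) : ℕ := d * (δ + 1 - d)

/-- `p = ∑_{j ∈ M_F(δ)} deg j = d ∑_{h=d}^{δ} h`. [cite: BombieriPila1989, §3] -/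
def bpP (d δ : ℕ) : ℕ := d * ∑ h ∈ Finset.Icc d δ, h

/-- `E = D(D-1)/2`. [folklore] -/
def bpE (d δ : ℕ) : ℕ := bpD d δ * (bpD d δ - 1) / 2

/-- The exponent `α = 2p/(D(D-1)) = p/E` of Bombieri–Pila. [cite: BombieriPila1989, §3] -/
noncomputable def bpα (d δ : ℕ) : ℝ := (bpP d δ : ℝ) / (bpE d δ : ℝ)

/-- The constant `W₁ = D! D^{p-D} (2^D A)^p` (Lemma 4 with `A' = 2^D A`). [folklore] -/
noncomputable def bpW₁ (d δ : ℕ) (A : ℝ) : ℝ :=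
  ((bpD d δ).factorial : ℝ) * (bpD d δ : ℝ) ^ (bpP d δ - bpD d δ) *
    ((2 : ℝ) ^ bpD d δ * A) ^ bpP d δ

/-- **Pieces of type (i)** (Bombieri–Pila, proof of Theorem 4). On a subinterval `[p, q]`
(`q - p ≤ N`, `N ≥ 1`) of a branch `g` of the absolutely irreducible curve `F = 0` of degree
`d`, on which `|g^{(ℓ)}| ≤ ℓ! A N^{1-ℓ}` for `1 ≤ ℓ ≤ D - 1` (`A ≥ 1`, `D = d(δ-d+1)`), the
number of lattice points is at most `(d+δ)⁴ (W₁^{1/E} (2N)^{p/E} + 1)`: translate by an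
integer vector so that the piece lies in `[0, 2N]` with `|g| ≤ 2N`, apply the Generalized Main
Lemma with `M = M_F(δ)` and count `≤ (d+δ)⁴` points per curve.
[cite: BombieriPila1989, proof of Theorem 4] -/
theorem typeI_count {F : MvPolynomial (Fin 2) ℝ} {d : ℕ} (hFd : F.totalDegree = d) (hd : 2 ≤ d)
    (hFirr : Irreducible (MvPolynomial.map (algebraMap ℝ ℂ) F)) {δ : ℕ} (hδ : d ≤ δ)
    {a b : ℝ} {g : ℝ → ℝ} (hg : IsSmoothBranch F a b g) {p q : ℝ} (hpq : p ≤ q)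
    (hsub : Set.Icc p q ⊆ Set.Ioo a b) {N A : ℝ} (hN : 1 ≤ N) (hqp : q - p ≤ N) (hA : 1 ≤ A)
    (hsmall : ∀ ℓ : ℕ, 1 ≤ ℓ → ℓ ≤ bpD d δ - 1 → ∀ x ∈ Set.Icc p q,
      |iteratedDeriv ℓ g x| ≤ ℓ.factorial * A * (N / N ^ ℓ)) :
    (latticeCount g p q : ℝ) ≤
      (d + δ : ℝ) ^ 4 * (bpW₁ d δ A ^ (1 / (bpE d δ : ℝ)) * (2 * N) ^ bpα d δ + 1) := by
  classical
  -- the translation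
  set m₀ : ℤ := ⌊p⌋ with hm₀
  set n₀ : ℤ := ⌊g p⌋ with hn₀
  set Ft := translate m₀ n₀ F with hFt
  set gt : ℝ → ℝ := fun x => g (x + m₀) - n₀ with hgt
  have hgtb : IsSmoothBranch Ft (a - m₀) (b - m₀) gt := isSmoothBranch_translate hg m₀ n₀
  have hFtd : Ft.totalDegree = d := (totalDegree_translate _ _ F).trans hFd
  have hFtirr : Irreducible Ft :=
    irreducible_of_irreducible_map_complex (irreducible_map_translate hFirr m₀ n₀)
  -- the monomial set
  set M := monSet (leadExp Ft) δ with hMdef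
  have hlead : (leadExp Ft).1 + (leadExp Ft).2 = d := (leadExp_sum Ft).trans hFtd
  have hMcard : M.card = d * (δ + 1 - d) := by rw [hMdef, card_monSet, hlead]
  have hMsum : ∑ j ∈ M, (j.1 + j.2) = d * ∑ h ∈ Finset.Icc d δ, h := by
    rw [hMdef, sum_deg_monSet, hlead]
  have hMdeg : ∀ j ∈ M, d ≤ j.1 + j.2 ∧ j.1 + j.2 ≤ δ := fun j hj => by
    have := mem_monSet hj; rw [hlead] at this; exact ⟨this.1, this.2.1⟩
  have hM1 : ∀ j ∈ M, 1 ≤ j.1 + j.2 := fun j hj => by have := (hMdeg j hj).1; omega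
  have hD2 : 2 ≤ M.card := by
    rw [hMcard]
    calc 2 ≤ d * 1 := by omega
      _ ≤ d * (δ + 1 - d) := Nat.mul_le_mul_left _ (by omega)
  -- geometry of the translated piece
  have hp0 : 0 ≤ p - m₀ := by rw [hm₀]; linarith [Int.floor_le p]
  have hp1 : p - m₀ < 1 := by rw [hm₀]; linarith [Int.lt_floor_add_one p]
  have hq2N : q - m₀ ≤ 2 * N := by linarith
  have hIU : Set.Icc (p - ↑m₀) (q - ↑m₀) ⊆ Set.Ioo (a - ↑m₀) (b - ↑m₀) := by
    intro x hx
    have := hsub (show x + m₀ ∈ Set.Icc p q from ⟨by linarith [hx.1], by linarith [hx.2]⟩)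
    exact ⟨by linarith [this.1], by linarith [this.2]⟩
  have hI0 : Set.Icc (p - ↑m₀) (q - ↑m₀) ⊆ Set.Icc 0 (2 * N) :=
    fun x hx => ⟨hp0.trans hx.1, hx.2.trans hq2N⟩
  -- derivative bounds for the translated branch
  have hN0 : 0 < N := by linarith
  have hA' : 1 ≤ (2 : ℝ) ^ M.card * A :=
    one_le_mul_of_one_le_of_one_le (one_le_pow₀ (by norm_num)) hA
  have hbound : DerivBoundOn gt (2 * N) (M.card - 1) (Set.Icc (p - ↑m₀) (q - ↑m₀))
      ((2 : ℝ) ^ M.card * A) := by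
    intro κ hκ x hx
    have hxm : x + m₀ ∈ Set.Icc p q := ⟨by linarith [hx.1], by linarith [hx.2]⟩
    rcases Nat.eq_zero_or_pos κ with rfl | hκ1
    · -- `|gt x| ≤ 2N`
      simp only [iteratedDeriv_zero, Nat.factorial_zero, Nat.cast_one, one_mul, pow_zero, div_one]
      have hmv : |g (x + m₀) - g p| ≤ 1 * |x + m₀ - p| := by
        have hdiff : ∀ y ∈ Set.Ioo a b, DifferentiableAt ℝ g y := fun y hy =>
          (hg.contDiffOn.differentiableOn (by simp)).differentiableAt (Ioo_mem_nhds hy.1 hy.2)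
        have := Convex.norm_image_sub_le_of_norm_deriv_le (f := g) hdiff
          (fun y hy => by rw [Real.norm_eq_abs]; exact hg.abs_deriv_le y hy)
          (convex_Ioo a b) (hsub (Set.left_mem_Icc.2 hpq)) (hsub hxm)
        simpa [Real.norm_eq_abs] using this
      have h1 : |x + ↑m₀ - p| ≤ N := by
        rw [abs_le]; constructor <;> linarith [hxm.1, hxm.2]
      have h2 : |g p - n₀| ≤ 1 := by
        rw [hn₀, abs_le]
        constructor <;> linarith [Int.floor_le (g p), Int.lt_floor_add_one (g p)]
      calc |gt x| = |(g (x + m₀) - g p) + (g p - n₀)| := by simp only [hgt]; ring_nf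
        _ ≤ |g (x + m₀) - g p| + |g p - n₀| := abs_add_le _ _
        _ ≤ N + 1 := by linarith
        _ ≤ 2 * N := by linarith
        _ ≤ 2 ^ M.card * A * (2 * N) := by nlinarith
    · rw [hgt, iteratedDeriv_translate g m₀ n₀ hκ1]
      have hs := hsmall κ hκ1 (by unfold bpD; rw [← hMcard]; exact hκ) (x + m₀) hxm
      refine hs.trans ?_
      have hk : (N / N ^ κ : ℝ) ≤ 2 ^ M.card * (2 * N / (2 * N) ^ κ) := by
        rw [mul_pow, show (2 : ℝ) ^ M.card * (2 * N / (2 ^ κ * N ^ κ)) =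
          (2 ^ (M.card + 1) / 2 ^ κ) * (N / N ^ κ) by rw [pow_succ]; field_simp]
        have : (1 : ℝ) ≤ 2 ^ (M.card + 1) / 2 ^ κ := by
          rw [le_div_iff₀ (by positivity), one_mul]
          exact pow_le_pow_right₀ (by norm_num) (by omega)
        have hpos : (0 : ℝ) ≤ N / N ^ κ := by positivity
        nlinarith
      have hf0 : (0 : ℝ) ≤ κ.factorial * A := by positivity
      calc (κ.factorial : ℝ) * A * (N / N ^ κ)
          ≤ κ.factorial * A * (2 ^ M.card * (2 * N / (2 * N) ^ κ)) :=
            mul_le_mul_of_nonneg_left hk hf0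
        _ = κ.factorial * (2 ^ M.card * A) * (2 * N / (2 * N) ^ κ) := by ring
  -- the Generalized Main Lemma
  obtain ⟨n, c, hn, hc0, hrel⟩ := generalizedMainLemma M hM1 hD2 (N := 2 * N)
    (A := 2 ^ M.card * A) (by linarith) (by positivity) isOpen_Ioo hIU Set.ordConnected_Icc hI0
    (hgtb.contDiffOn.of_le (WithTop.coe_le_coe.mpr le_top)) hbound
  -- points per curve
  have hcount : latticeCount gt (p - m₀) (q - m₀) ≤ n * (Ft.totalDegree + δ) ^ 4 := by
    refine latticeCount_le_of_curves hFtirr hc0 hrel ?_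
    intro m n' hmI hmn
    have := hgtb.eval_eq_zero m (hIU hmI)
    rwa [hmn] at this
  rw [hFtd] at hcount
  -- assemble
  have hcurves := curveCount_le M hM1 hD2 (N := 2 * N) (A := 2 ^ M.card * A) (by linarith) hA'
  rw [hMsum, hMcard] at hcurves
  rw [hMcard] at hn
  have h1 : (latticeCount g p q : ℝ) ≤ latticeCount gt (p - m₀) (q - m₀) := by
    exact_mod_cast latticeCount_translate g p q m₀ n₀
  have h2 : (latticeCount gt (p - m₀) (q - m₀) : ℝ) ≤ n * (d + δ : ℝ) ^ 4 := by
    exact_mod_cast hcount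
  calc (latticeCount g p q : ℝ) ≤ n * (d + δ : ℝ) ^ 4 := h1.trans h2
    _ = (d + δ : ℝ) ^ 4 * n := mul_comm _ _
    _ ≤ (d + δ : ℝ) ^ 4 * (2 * N * gmlW M (2 * N) (2 ^ (d * (δ + 1 - d)) * A) ^
          (2 / (((d * (δ + 1 - d) : ℕ) : ℝ) * (d * (δ + 1 - d) - 1 : ℕ))) + 1) := by gcongr
    _ ≤ _ := by
        unfold bpW₁ bpα bpE bpP bpD
        exact mul_le_mul_of_nonneg_left (by linarith [hcurves]) (by positivity)

end TypeIPiece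

/-! ### The recursion of the proof of Theorem 4 -/

section Recursion

variable {F : MvPolynomial (Fin 2) ℝ} {d : ℕ}

/-- `Tmax = 2(D-1)(4Dd)⁴` bounds the number of division points. [folklore] -/
def bpTmax (d δ : ℕ) : ℕ := 2 * (bpD d δ - 1) * (4 * bpD d δ * d) ^ 4

/-- **Division points** (Bombieri–Pila, Lemma 6 in weak form). For a branch `g` of `F = 0`
over `(a, b)`, thresholds `th ℓ`, and `[u, v] ⊆ (a, b)`, there is a finite set `T₀ ⊆ [u, v]`
with `#T₀ ≤ 2(D-1)(4Dd)⁴` such that for every `1 ≤ ℓ ≤ D - 1` and `s = ±1`, either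
`g^{(ℓ)} ≡ s · th ℓ` on `(a, b)` or every solution of `g^{(ℓ)} = s · th ℓ` in `[u, v]` lies in
`T₀`. [cite: BombieriPila1989, Lemma 6] -/
theorem exists_division_finset (hF : Irreducible F) (hFd : F.totalDegree = d) (hd : 2 ≤ d)
    (δ : ℕ) {a b : ℝ} {g : ℝ → ℝ} (hg : ContDiffOn ℝ ∞ g (Set.Ioo a b))
    (hz : ∀ x ∈ Set.Ioo a b, MvPolynomial.eval ![x, g x] F = 0) (th : ℕ → ℝ) {u v : ℝ}
    (huv : Set.Icc u v ⊆ Set.Ioo a b) :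
    ∃ T₀ : Finset ℝ, (∀ t ∈ T₀, t ∈ Set.Icc u v) ∧ T₀.card ≤ bpTmax d δ ∧
      ∀ ℓ : ℕ, 1 ≤ ℓ → ℓ ≤ bpD d δ - 1 → ∀ s : ℝ, (s = 1 ∨ s = -1) →
        (∀ x ∈ Set.Ioo a b, iteratedDeriv ℓ g x = s * th ℓ) ∨
          (∀ x ∈ Set.Icc u v, iteratedDeriv ℓ g x = s * th ℓ → x ∈ T₀) := by
  classical
  have hd' : 2 ≤ F.totalDegree := hFd ▸ hd
  -- the level sets
  set L : ℕ → ℝ → Set ℝ := fun ℓ s => {x ∈ Set.Ioo a b | iteratedDeriv ℓ g x = s * th ℓ} with hL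
  have hdich : ∀ ℓ : ℕ, 1 ≤ ℓ → ∀ s : ℝ, (∀ x ∈ Set.Ioo a b, iteratedDeriv ℓ g x = s * th ℓ) ∨
      ((L ℓ s).Finite ∧ (L ℓ s).ncard ≤ (4 * ℓ * d) ^ 4) := by
    intro ℓ hℓ s
    obtain ⟨k, rfl⟩ : ∃ k, ℓ = k + 1 := ⟨ℓ - 1, by omega⟩
    have := levelSet_dichotomy hF hd' hg hz k (s * th (k + 1))
    rw [hFd] at this
    exact this
  -- the finite pieces, as finsets
  set piece : ℕ × ℝ → Finset ℝ := fun ls =>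
    if h : (L ls.1 ls.2).Finite then h.toFinset.filter (fun x => x ∈ Set.Icc u v) else ∅ with hpiece
  set idx : Finset (ℕ × ℝ) := (Finset.Icc 1 (bpD d δ - 1)) ×ˢ ({1, -1} : Finset ℝ) with hidx
  refine ⟨idx.biUnion piece, ?_, ?_, ?_⟩
  · intro t ht
    rw [Finset.mem_biUnion] at ht
    obtain ⟨ls, -, hls⟩ := ht
    simp only [hpiece] at hls
    split_ifs at hls with h
    · exact (Finset.mem_filter.1 hls).2
    · exact absurd hls (Finset.notMem_empty t)
  · refine Finset.card_biUnion_le.trans ?_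
    have hb : ∀ ls ∈ idx, (piece ls).card ≤ (4 * bpD d δ * d) ^ 4 := by
      intro ls hls
      rw [hidx, Finset.mem_product, Finset.mem_Icc] at hls
      simp only [hpiece]
      split_ifs with h
      · refine (Finset.card_filter_le _ _).trans ?_
        rcases hdich ls.1 hls.1.1 ls.2 with hall | ⟨hfin, hcard⟩
        · -- the level set is everything: then `L` is all of `(a, b)`; the bound need not hold,
          -- but in this case we may bound by the finite-case estimate only if finite; use `h`.
          -- Since `L ls.1 ls.2 = Ioo a b` is finite here, it is in fact bounded as claimed:
          -- a finite open interval is empty.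
          have hsub : Set.Ioo a b ⊆ L ls.1 ls.2 := fun x hx => ⟨hx, hall x hx⟩
          rcases Set.eq_empty_or_nonempty (Set.Ioo a b) with he | hne
          · have : L ls.1 ls.2 = ∅ := Set.subset_eq_empty (fun x hx => hx.1) he
            simp [this]
          · obtain ⟨x, hx⟩ := hne
            exact absurd (h.subset hsub) (Set.Ioo_infinite (lt_trans hx.1 hx.2))
        · rw [← Set.ncard_eq_toFinset_card _ hfin]
          refine hcard.trans (Nat.pow_le_pow_left ?_ 4)
          have := hls.1.2
          exact Nat.mul_le_mul_right d (Nat.mul_le_mul_left 4 (by omega))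
      · simp
    calc ∑ ls ∈ idx, (piece ls).card ≤ ∑ _ls ∈ idx, (4 * bpD d δ * d) ^ 4 := Finset.sum_le_sum hb
      _ = idx.card * (4 * bpD d δ * d) ^ 4 := by simp
      _ ≤ bpTmax d δ := by
          rw [bpTmax, hidx, Finset.card_product, Nat.card_Icc]
          have : ({1, -1} : Finset ℝ).card ≤ 2 := Finset.card_le_two
          calc (bpD d δ - 1 + 1 - 1) * ({1, -1} : Finset ℝ).card * (4 * bpD d δ * d) ^ 4
              ≤ (bpD d δ - 1) * 2 * (4 * bpD d δ * d) ^ 4 := by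
                refine Nat.mul_le_mul_right _ (Nat.mul_le_mul (by omega) this)
            _ = 2 * (bpD d δ - 1) * (4 * bpD d δ * d) ^ 4 := by ring
  · intro ℓ hℓ1 hℓ2 s hs
    rcases hdich ℓ hℓ1 s with hall | ⟨hfin, -⟩
    · exact Or.inl hall
    · right
      intro x hx hxeq
      have hmem : (ℓ, s) ∈ idx := by
        rw [hidx, Finset.mem_product, Finset.mem_Icc]
        refine ⟨⟨hℓ1, hℓ2⟩, ?_⟩
        rcases hs with rfl | rfl <;> simp
      refine Finset.mem_biUnion.2 ⟨(ℓ, s), hmem, ?_⟩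
      simp only [hpiece, dif_pos hfin]
      exact Finset.mem_filter.2 ⟨hfin.mem_toFinset.2 ⟨huv hx, hxeq⟩, hx⟩

/-- **Classification of a piece** between consecutive division points: for each `ℓ`, either
`|g^{(ℓ)}| ≤ th ℓ` on the closed piece or `|g^{(ℓ)}| ≥ th ℓ` on it.
[cite: BombieriPila1989, Lemma 6] -/
theorem piece_dichotomy {a b u v : ℝ} {g : ℝ → ℝ} (hg : ContDiffOn ℝ ∞ g (Set.Ioo a b))
    (huv : Set.Icc u v ⊆ Set.Ioo a b) (hle : u ≤ v) {D : ℕ} {th : ℕ → ℝ} {T₀ : Finset ℝ}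
    (hT₀ : ∀ t ∈ T₀, t ∈ Set.Icc u v)
    (hdiv : ∀ ℓ : ℕ, 1 ≤ ℓ → ℓ ≤ D - 1 → ∀ s : ℝ, (s = 1 ∨ s = -1) →
      (∀ x ∈ Set.Ioo a b, iteratedDeriv ℓ g x = s * th ℓ) ∨
        (∀ x ∈ Set.Icc u v, iteratedDeriv ℓ g x = s * th ℓ → x ∈ T₀))
    {pq : ℝ × ℝ} (hpq : pq ∈ ((insert u (insert v T₀)) ×ˢ (insert u (insert v T₀))).filter
      (fun pq : ℝ × ℝ => pq.1 < pq.2 ∧ ∀ t ∈ insert u (insert v T₀), ¬ (pq.1 < t ∧ t < pq.2))) :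
    Set.Icc pq.1 pq.2 ⊆ Set.Icc u v ∧ pq.1 < pq.2 ∧
      ∀ ℓ : ℕ, 1 ≤ ℓ → ℓ ≤ D - 1 →
        (∀ x ∈ Set.Icc pq.1 pq.2, |iteratedDeriv ℓ g x| ≤ th ℓ) ∨
          (∀ x ∈ Set.Icc pq.1 pq.2, th ℓ ≤ |iteratedDeriv ℓ g x|) := by
  obtain ⟨hmem, hlt, hcons⟩ := Finset.mem_filter.1 hpq
  obtain ⟨h1, h2⟩ := Finset.mem_product.1 hmem
  have hT : ∀ t ∈ insert u (insert v T₀), t ∈ Set.Icc u v := by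
    intro t ht
    simp only [Finset.mem_insert] at ht
    rcases ht with rfl | rfl | ht
    · exact ⟨le_rfl, hle⟩
    · exact ⟨hle, le_rfl⟩
    · exact hT₀ t ht
  have hsub : Set.Icc pq.1 pq.2 ⊆ Set.Icc u v := fun x hx =>
    ⟨(hT _ h1).1.trans hx.1, hx.2.trans (hT _ h2).2⟩
  refine ⟨hsub, hlt, fun ℓ hℓ1 hℓ2 => ?_⟩
  have hcont : ContinuousOn (iteratedDeriv ℓ g) (Set.Ioo a b) :=
    continuousOn_iteratedDeriv isOpen_Ioo hg ℓ
  refine abs_le_or_le_abs hcont hlt (hsub.trans huv) ?_ ?_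
  · rcases hdiv ℓ hℓ1 hℓ2 1 (Or.inl rfl) with h | h
    · left; simpa using h
    · right
      intro x hx heq
      have hxT : x ∈ T₀ := h x (hsub (Set.Ioo_subset_Icc_self hx)) (by simpa using heq)
      exact hcons x (Finset.mem_insert_of_mem (Finset.mem_insert_of_mem hxT)) hx
  · rcases hdiv ℓ hℓ1 hℓ2 (-1) (Or.inr rfl) with h | h
    · left; simpa using h
    · right
      intro x hx heq
      have hxT : x ∈ T₀ := h x (hsub (Set.Ioo_subset_Icc_self hx)) (by simpa using heq)
      exact hcons x (Finset.mem_insert_of_mem (Finset.mem_insert_of_mem hxT)) hx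

/-- **Pieces of type (ii) are short** (Lemma 7 applied at the first large derivative): if not all
derivatives of orders `1 ≤ ℓ ≤ D-1` are `≤ ℓ! B^ℓ N^{1-ℓ}` on the piece `[p, q]`, then
`q - p ≤ 2N/B`. [cite: BombieriPila1989, proof of Theorem 4] -/
theorem typeII_length {a b p q : ℝ} {g : ℝ → ℝ} (hg : ContDiffOn ℝ ∞ g (Set.Ioo a b))
    (hg1 : ∀ x ∈ Set.Ioo a b, |deriv g x| ≤ 1) (hsub : Set.Icc p q ⊆ Set.Ioo a b) (hpq : p < q)
    {N B : ℝ} (hN : 0 < N) (hB : 0 < B) (hqp : q - p ≤ N) {D : ℕ}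
    (hclass : ∀ ℓ : ℕ, 1 ≤ ℓ → ℓ ≤ D - 1 →
      (∀ x ∈ Set.Icc p q, |iteratedDeriv ℓ g x| ≤ ℓ.factorial * B ^ ℓ * (N / N ^ ℓ)) ∨
        (∀ x ∈ Set.Icc p q, ℓ.factorial * B ^ ℓ * (N / N ^ ℓ) ≤ |iteratedDeriv ℓ g x|))
    (hnot : ¬ ∀ ℓ : ℕ, 1 ≤ ℓ → ℓ ≤ D - 1 →
      ∀ x ∈ Set.Icc p q, |iteratedDeriv ℓ g x| ≤ ℓ.factorial * B ^ ℓ * (N / N ^ ℓ)) :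
    q - p ≤ 2 * N / B := by
  classical
  push Not at hnot
  -- the least order with a large derivative
  have hex : ∃ k : ℕ, 1 ≤ k ∧ k ≤ D - 1 ∧
      ¬ ∀ x ∈ Set.Icc p q, |iteratedDeriv k g x| ≤ k.factorial * B ^ k * (N / N ^ k) := by
    obtain ⟨ℓ, h1, h2, x, hx, hlt⟩ := hnot
    exact ⟨ℓ, h1, h2, fun h => absurd (h x hx) (not_le.2 hlt)⟩
  set k := Nat.find hex with hk
  obtain ⟨hk1, hk2, hknot⟩ := Nat.find_spec hex
  have hlarge : ∀ x ∈ Set.Icc p q, k.factorial * B ^ k * (N / N ^ k) ≤ |iteratedDeriv k g x| :=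
    (hclass k hk1 hk2).resolve_left hknot
  have hsmall : ∀ i : ℕ, 1 ≤ i → i < k →
      |iteratedDeriv i g p| ≤ i.factorial * B ^ i * (N / N ^ i) := by
    intro i hi1 hik
    have hmin := Nat.find_min hex (show i < Nat.find hex from hik)
    push Not at hmin
    exact hmin hi1 (by omega) p (Set.left_mem_Icc.2 hpq.le)
  have hdiff : |g q - g p| ≤ N := by
    have hd : ∀ y ∈ Set.Ioo a b, DifferentiableAt ℝ g y := fun y hy =>
      (hg.differentiableOn (by simp)).differentiableAt (Ioo_mem_nhds hy.1 hy.2)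
    have := Convex.norm_image_sub_le_of_norm_deriv_le (f := g) hd
      (fun y hy => by rw [Real.norm_eq_abs]; exact hg1 y hy) (convex_Ioo a b)
      (hsub (Set.left_mem_Icc.2 hpq.le)) (hsub (Set.right_mem_Icc.2 hpq.le))
    rw [Real.norm_eq_abs, Real.norm_eq_abs, one_mul, abs_of_pos (sub_pos.2 hpq)] at this
    linarith
  exact length_le_of_derivative_bounds isOpen_Ioo hg hpq hsub hN hB hk1 hdiff hsmall hlarge

/-- `B = A^{1/(D-1)}`. [cite: BombieriPila1989, proof of Theorem 4] -/
noncomputable def bpB (d δ : ℕ) (A : ℝ) : ℝ := A ^ (1 / ((bpD d δ - 1 : ℕ) : ℝ))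

/-- `λ = 2 A^{-1/(D-1)} = 2/B`, the contraction factor of the recursion.
[cite: BombieriPila1989, proof of Theorem 4] -/
noncomputable def bpLam (d δ : ℕ) (A : ℝ) : ℝ := 2 / bpB d δ A

/-- `K₀ = (Tmax + 2)²`, the bound for the number of pieces (the paper's `K = 2d⁴δ²` via
Lemma 5; here from the weak Bézout bound). [folklore] -/
noncomputable def bpK₀ (d δ : ℕ) : ℝ := ((bpTmax d δ + 2) ^ 2 : ℕ)

/-- `H₁ = (d+δ)⁴ (W₁^{1/E} 2^α + 1)`, the constant of the type (i) bound. [folklore] -/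
noncomputable def bpH₁ (d δ : ℕ) (A : ℝ) : ℝ :=
  (d + δ : ℝ) ^ 4 * (bpW₁ d δ A ^ (1 / (bpE d δ : ℝ)) * 2 ^ bpα d δ + 1)

/-- `H = K₀ H₁` (the paper's `H`). [cite: BombieriPila1989, proof of Theorem 4] -/
noncomputable def bpH (d δ : ℕ) (A : ℝ) : ℝ := bpK₀ d δ * bpH₁ d δ A

/-- The partial geometric sums `S n = ∑_{i<n} (K₀ λ^α)^i` of the recursion. [folklore] -/
noncomputable def bpS (d δ : ℕ) (A : ℝ) (n : ℕ) : ℝ :=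
  ∑ i ∈ Finset.range n, (bpK₀ d δ * bpLam d δ A ^ bpα d δ) ^ i

/-- Auxiliary lemma `bpα_nonneg`. [folklore] -/
theorem bpα_nonneg (d δ : ℕ) : 0 ≤ bpα d δ := by unfold bpα; positivity

/-- Auxiliary lemma `bpD_two_le`. [folklore] -/
theorem bpD_two_le {d δ : ℕ} (hd : 2 ≤ d) (hδ : d ≤ δ) : 2 ≤ bpD d δ := by
  unfold bpD
  calc 2 ≤ d * 1 := by omega
    _ ≤ d * (δ + 1 - d) := Nat.mul_le_mul_left _ (by omega)

/-- Auxiliary lemma `one_le_bpB`. [folklore] -/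
theorem one_le_bpB {d δ : ℕ} {A : ℝ} (hA : 1 ≤ A) : 1 ≤ bpB d δ A :=
  Real.one_le_rpow hA (by positivity)

/-- Auxiliary lemma `bpB_pow_le`. [folklore] -/
theorem bpB_pow_le {d δ : ℕ} (hd : 2 ≤ d) (hδ : d ≤ δ) {A : ℝ} (hA : 1 ≤ A) {ℓ : ℕ}
    (hℓ : ℓ ≤ bpD d δ - 1) : bpB d δ A ^ ℓ ≤ A := by
  have hB := one_le_bpB (d := d) (δ := δ) hA
  calc bpB d δ A ^ ℓ ≤ bpB d δ A ^ (bpD d δ - 1) := pow_le_pow_right₀ hB hℓ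
    _ = A := by
        unfold bpB
        rw [← Real.rpow_natCast, ← Real.rpow_mul (by linarith)]
        have : (1 / ((bpD d δ - 1 : ℕ) : ℝ)) * ((bpD d δ - 1 : ℕ) : ℝ) = 1 := by
          have : (0 : ℝ) < ((bpD d δ - 1 : ℕ) : ℝ) := by
            have := bpD_two_le hd hδ; exact_mod_cast (by omega : 0 < bpD d δ - 1)
          field_simp
        rw [this, Real.rpow_one]

/-- Auxiliary lemma `bpS_succ`. [folklore] -/
theorem bpS_succ (d δ : ℕ) (A : ℝ) (n : ℕ) :
    bpS d δ A (n + 1) = 1 + (bpK₀ d δ * bpLam d δ A ^ bpα d δ) * bpS d δ A n := by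
  unfold bpS
  rw [Finset.sum_range_succ', pow_zero, Finset.mul_sum, add_comm]
  congr 1
  refine Finset.sum_congr rfl fun i _ => ?_
  rw [pow_succ]; ring

/-- Auxiliary lemma `one_le_bpK₀`. [folklore] -/
theorem one_le_bpK₀ (d δ : ℕ) : 1 ≤ bpK₀ d δ := by
  unfold bpK₀; exact_mod_cast Nat.one_le_pow _ _ (by omega)

/-- **Type (i) pieces in the form `≤ H₁ N^α`.** [cite: BombieriPila1989, proof of Theorem 4] -/
theorem typeI_count' (hFd : F.totalDegree = d) (hd : 2 ≤ d)
    (hFirr : Irreducible (MvPolynomial.map (algebraMap ℝ ℂ) F)) {δ : ℕ} (hδ : d ≤ δ)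
    {a b : ℝ} {g : ℝ → ℝ} (hg : IsSmoothBranch F a b g) {p q : ℝ} (hpq : p ≤ q)
    (hsub : Set.Icc p q ⊆ Set.Ioo a b) {N A : ℝ} (hN : 1 ≤ N) (hqp : q - p ≤ N) (hA : 1 ≤ A)
    (hsmall : ∀ ℓ : ℕ, 1 ≤ ℓ → ℓ ≤ bpD d δ - 1 → ∀ x ∈ Set.Icc p q,
      |iteratedDeriv ℓ g x| ≤ ℓ.factorial * bpB d δ A ^ ℓ * (N / N ^ ℓ)) :
    (latticeCount g p q : ℝ) ≤ bpH₁ d δ A * N ^ bpα d δ := by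
  have h := typeI_count hFd hd hFirr hδ hg hpq hsub hN hqp hA (fun ℓ h1 h2 x hx =>
    (hsmall ℓ h1 h2 x hx).trans (by
      have := bpB_pow_le hd hδ hA h2
      have h0 : (0 : ℝ) ≤ ℓ.factorial * (N / N ^ ℓ) := by positivity
      nlinarith))
  refine h.trans ?_
  unfold bpH₁
  have hN0 : 0 ≤ N := by linarith
  have hα := bpα_nonneg d δ
  rw [Real.mul_rpow (by norm_num) hN0, mul_assoc ((d + δ : ℝ) ^ 4)]
  refine mul_le_mul_of_nonneg_left ?_ (by positivity)
  have h1 : 1 ≤ N ^ bpα d δ := Real.one_le_rpow hN hα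
  have h2 : 0 ≤ bpW₁ d δ A ^ (1 / (bpE d δ : ℝ)) * 2 ^ bpα d δ := by
    unfold bpW₁; positivity
  nlinarith

/-- **The recursion of Bombieri–Pila's proof of Theorem 4.** For all `n`: every closed
subinterval `[u, v]` of length `≤ N < λ^{-n}` of a smooth branch of slope `≤ 1` of an absolutely
irreducible curve of degree `d` carries at most `H N^α S_n + K₀^n` lattice points, where
`S_n = ∑_{i<n} (K₀λ^α)^i` (`G(N) ≤ H N^α (1 + Kλ^α + ⋯) + K^n G(λ^n N)` in the paper).
[cite: BombieriPila1989, proof of Theorem 4] -/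
theorem recursion (hd : 2 ≤ d) {δ : ℕ} (hδ : d ≤ δ) {A : ℝ} (hA : 1 ≤ A) (n : ℕ) :
    ∀ (F : MvPolynomial (Fin 2) ℝ), F.totalDegree = d →
      Irreducible (MvPolynomial.map (algebraMap ℝ ℂ) F) →
    ∀ (a b : ℝ) (g : ℝ → ℝ), IsSmoothBranch F a b g →
    ∀ u v : ℝ, a < u → u ≤ v → v < b → ∀ N : ℝ, 0 < N → v - u ≤ N →
      N < (1 / bpLam d δ A) ^ n →
      (latticeCount g u v : ℝ) ≤ bpH d δ A * N ^ bpα d δ * bpS d δ A n + bpK₀ d δ ^ n := by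
  have hK₀ := one_le_bpK₀ d δ
  have hB1 := one_le_bpB (d := d) (δ := δ) hA
  have hB0 : 0 < bpB d δ A := by linarith
  have hlam0 : 0 < bpLam d δ A := by unfold bpLam; positivity
  have hα := bpα_nonneg d δ
  have hH₁ : 0 ≤ bpH₁ d δ A := by unfold bpH₁ bpW₁; positivity
  have hH : 0 ≤ bpH d δ A := by unfold bpH; positivity
  have hS : ∀ n, 0 ≤ bpS d δ A n := fun n => by
    unfold bpS; exact Finset.sum_nonneg fun i _ => by positivity
  induction n with
  | zero =>
    intro F hFd hFirr a b g hg u v hau huv hvb N hN hvu hNn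
    rw [pow_zero] at hNn
    have h1 : (latticeCount g u v : ℝ) ≤ 1 := by exact_mod_cast latticeCount_le_one (by linarith)
    have h2 : 0 ≤ bpH d δ A * N ^ bpα d δ * bpS d δ A 0 := by
      have := hS 0; positivity
    rw [pow_zero]; linarith
  | succ n ih =>
    intro F hFd hFirr a b g hg u v hau huv hvb N hN hvu hNn
    have hpos : 0 ≤ bpH d δ A * N ^ bpα d δ * bpS d δ A (n + 1) := by
      have := hS (n + 1); positivity
    have hK₀n : 1 ≤ bpK₀ d δ ^ (n + 1) := one_le_pow₀ hK₀
    -- short intervals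
    by_cases hshort : v - u < 1
    · have h1 : (latticeCount g u v : ℝ) ≤ 1 := by exact_mod_cast latticeCount_le_one hshort
      linarith
    push Not at hshort
    have huv' : u < v := by linarith
    have hN1 : 1 ≤ N := by linarith
    have hIuv : Set.Icc u v ⊆ Set.Ioo a b := fun x hx => ⟨by linarith [hx.1], by linarith [hx.2]⟩
    -- thresholds and division points
    set th : ℕ → ℝ := fun ℓ => ℓ.factorial * bpB d δ A ^ ℓ * (N / N ^ ℓ) with hth
    have hFirrR : Irreducible F := irreducible_of_irreducible_map_complex hFirr
    obtain ⟨T₀, hT₀, hT₀card, hdiv⟩ := exists_division_finset hFirrR hFd hd δ hg.contDiffOn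
      hg.eval_eq_zero th hIuv
    set T : Finset ℝ := insert u (insert v T₀) with hT
    have huT : u ∈ T := Finset.mem_insert_self _ _
    have hvT : v ∈ T := Finset.mem_insert_of_mem (Finset.mem_insert_self _ _)
    set CP := (T ×ˢ T).filter
      (fun pq : ℝ × ℝ => pq.1 < pq.2 ∧ ∀ t ∈ T, ¬ (pq.1 < t ∧ t < pq.2)) with hCP
    have hCPcard : (CP.card : ℝ) ≤ bpK₀ d δ := by
      have h1 : CP.card ≤ (T ×ˢ T).card := Finset.card_filter_le _ _
      have h2 : T.card ≤ bpTmax d δ + 2 := by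
        calc T.card ≤ (insert v T₀).card + 1 := Finset.card_insert_le _ _
          _ ≤ T₀.card + 1 + 1 := by gcongr; exact Finset.card_insert_le _ _
          _ ≤ bpTmax d δ + 2 := by omega
      rw [Finset.card_product] at h1
      unfold bpK₀
      exact_mod_cast h1.trans (by rw [sq]; exact Nat.mul_le_mul h2 h2)
    -- bound for each piece
    have hpiece : ∀ pq ∈ CP, (latticeCount g pq.1 pq.2 : ℝ) ≤ bpH₁ d δ A * N ^ bpα d δ +
        (bpH d δ A * (bpLam d δ A * N) ^ bpα d δ * bpS d δ A n + bpK₀ d δ ^ n) := by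
      intro pq hpq
      obtain ⟨hsub, hlt, hclass⟩ := piece_dichotomy hg.contDiffOn hIuv huv hT₀ hdiv hpq
      have hsub' : Set.Icc pq.1 pq.2 ⊆ Set.Ioo a b := hsub.trans hIuv
      have hlen : pq.2 - pq.1 ≤ N := by
        have := (hsub (Set.left_mem_Icc.2 hlt.le)).1
        have := (hsub (Set.right_mem_Icc.2 hlt.le)).2
        linarith
      have hnn1 : 0 ≤ bpH₁ d δ A * N ^ bpα d δ := by positivity
      have hnn2 : 0 ≤ bpH d δ A * (bpLam d δ A * N) ^ bpα d δ * bpS d δ A n + bpK₀ d δ ^ n := by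
        have := hS n; positivity
      by_cases htype : ∀ ℓ : ℕ, 1 ≤ ℓ → ℓ ≤ bpD d δ - 1 →
          ∀ x ∈ Set.Icc pq.1 pq.2, |iteratedDeriv ℓ g x| ≤ ℓ.factorial * bpB d δ A ^ ℓ * (N / N ^ ℓ)
      · -- type (i)
        have := typeI_count' hFd hd hFirr hδ hg hlt.le hsub' hN1 hlen hA htype
        linarith
      · -- type (ii): the piece is short, recurse
        have hshortp : pq.2 - pq.1 ≤ 2 * N / bpB d δ A :=
          typeII_length hg.contDiffOn hg.abs_deriv_le hsub' hlt hN hB0 hlen hclass htype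
        have hlamN : pq.2 - pq.1 ≤ bpLam d δ A * N := by
          unfold bpLam
          rw [div_mul_eq_mul_div]
          exact hshortp
        have hNn' : bpLam d δ A * N < (1 / bpLam d δ A) ^ n := by
          have h1 : (1 / bpLam d δ A) ^ (n + 1) = (1 / bpLam d δ A) ^ n / bpLam d δ A := by
            rw [pow_succ]; field_simp
          rw [h1, lt_div_iff₀ hlam0] at hNn
          linarith
        have hrec := ih F hFd hFirr a b g hg pq.1 pq.2 (hsub' (Set.left_mem_Icc.2 hlt.le)).1
          hlt.le (hsub' (Set.right_mem_Icc.2 hlt.le)).2 (bpLam d δ A * N) (by positivity)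
          hlamN hNn'
        linarith
    -- sum over the pieces
    have hsum : (latticeCount g u v : ℝ) ≤ ∑ pq ∈ CP, (latticeCount g pq.1 pq.2 : ℝ) := by
      exact_mod_cast latticeCount_le_sum (g := g) huT hvT huv'
    refine hsum.trans ?_
    calc ∑ pq ∈ CP, (latticeCount g pq.1 pq.2 : ℝ)
        ≤ ∑ _pq ∈ CP, (bpH₁ d δ A * N ^ bpα d δ +
            (bpH d δ A * (bpLam d δ A * N) ^ bpα d δ * bpS d δ A n + bpK₀ d δ ^ n)) :=
          Finset.sum_le_sum hpiece
      _ = CP.card * (bpH₁ d δ A * N ^ bpα d δ +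
            (bpH d δ A * (bpLam d δ A * N) ^ bpα d δ * bpS d δ A n + bpK₀ d δ ^ n)) := by
          rw [Finset.sum_const, nsmul_eq_mul]
      _ ≤ bpK₀ d δ * (bpH₁ d δ A * N ^ bpα d δ +
            (bpH d δ A * (bpLam d δ A * N) ^ bpα d δ * bpS d δ A n + bpK₀ d δ ^ n)) := by
          have : 0 ≤ bpH₁ d δ A * N ^ bpα d δ +
              (bpH d δ A * (bpLam d δ A * N) ^ bpα d δ * bpS d δ A n + bpK₀ d δ ^ n) := by
            have := hS n; positivity
          exact mul_le_mul_of_nonneg_right hCPcard this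
      _ = bpH d δ A * N ^ bpα d δ * bpS d δ A (n + 1) + bpK₀ d δ ^ (n + 1) := by
          rw [bpS_succ, Real.mul_rpow hlam0.le hN.le, pow_succ]
          unfold bpH
          ring

end Recursion


/-! ### The exponent and the choice of the constants -/

section Final

/-- **The exponent bound** `α = 2p/(D(D-1)) ≤ 1/d + 4/δ` for `δ ≥ 2d` (Bombieri–Pila, §3:
`1/d ≤ 2p/(D(D-1)) ≤ 1/d + 4/δ`). [cite: BombieriPila1989, §3] -/
theorem bpα_le {d δ : ℕ} (hd : 2 ≤ d) (hδ : 2 * d ≤ δ) :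
    bpα d δ ≤ 1 / (d : ℝ) + 4 / (δ : ℝ) := by
  have hdδ : d ≤ δ := by omega
  set L := δ + 1 - d with hL
  have hL1 : 1 ≤ L := by omega
  have hD : bpD d δ = d * L := rfl
  -- `p = d · L(δ+d)/2`
  have hp2 : (bpP d δ : ℝ) * 2 = (d : ℝ) * L * (δ + d : ℕ) := by
    have := sum_Icc_mul_two d δ hdδ
    unfold bpP
    have h : ((d * ∑ h ∈ Finset.Icc d δ, h : ℕ) : ℝ) * 2 =
        (d : ℝ) * ((∑ h ∈ Finset.Icc d δ, h) * 2 : ℕ) := by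
      push_cast; ring
    rw [h, this, hL]
    push_cast
    ring
  have hE : ((bpE d δ : ℕ) : ℝ) = (bpD d δ : ℝ) * (bpD d δ - 1 : ℕ) / 2 := cast_choose_two _
  have hD2 := bpD_two_le hd hdδ
  have hDpos : (0 : ℝ) < (bpD d δ : ℝ) * (bpD d δ - 1 : ℕ) := by
    have : (2 : ℝ) ≤ bpD d δ := by exact_mod_cast hD2
    have : (1 : ℝ) ≤ (bpD d δ - 1 : ℕ) := by exact_mod_cast (by omega : 1 ≤ bpD d δ - 1)
    positivity
  -- `α = (δ + d)/(dL - 1)`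
  have hD1pos : (0 : ℝ) < ((bpD d δ - 1 : ℕ) : ℝ) := by
    exact_mod_cast (by omega : 0 < bpD d δ - 1)
  have hEpos : (0 : ℝ) < (bpE d δ : ℝ) := by rw [hE]; positivity
  have hDr : (bpD d δ : ℝ) = (d : ℝ) * L := by rw [hD]; push_cast; ring
  have hα : bpα d δ = ((δ + d : ℕ) : ℝ) / ((bpD d δ - 1 : ℕ) : ℝ) := by
    unfold bpα
    rw [div_eq_div_iff hEpos.ne' hD1pos.ne', hE]
    linear_combination ((bpD d δ - 1 : ℕ) : ℝ) / 2 * hp2 -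
      ((δ + d : ℕ) : ℝ) * ((bpD d δ - 1 : ℕ) : ℝ) / 2 * hDr
  rw [hα]
  have hdr : (0 : ℝ) < d := by exact_mod_cast (by omega : 0 < d)
  have hδr : (0 : ℝ) < δ := by exact_mod_cast (by omega : 0 < δ)
  have hden : (d : ℝ) * (δ - d : ℕ) ≤ ((bpD d δ - 1 : ℕ) : ℝ) := by
    have h1 : d * (δ - d) ≤ bpD d δ - 1 := by
      rw [hD, hL]
      have : d * (δ + 1 - d) = d * (δ - d) + d := by
        rw [show δ + 1 - d = (δ - d) + 1 by omega, Nat.mul_add, mul_one]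
      omega
    exact_mod_cast h1
  have hδd : (0 : ℝ) < (δ - d : ℕ) := by exact_mod_cast (by omega : 0 < δ - d)
  calc ((δ + d : ℕ) : ℝ) / ((bpD d δ - 1 : ℕ) : ℝ)
      ≤ ((δ + d : ℕ) : ℝ) / ((d : ℝ) * (δ - d : ℕ)) := by
        gcongr
    _ = 1 / d + 2 / ((δ - d : ℕ) : ℝ) := by
        push_cast
        field_simp
        push_cast [Nat.cast_sub hdδ]
        ring
    _ ≤ 1 / d + 4 / δ := by
        have : (2 : ℝ) / ((δ - d : ℕ) : ℝ) ≤ 4 / δ := by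
          rw [div_le_div_iff₀ hδd hδr]
          have : ((δ - d : ℕ) : ℝ) = δ - d := by push_cast [Nat.cast_sub hdδ]; ring
          rw [this]
          have : (2 : ℝ) * d ≤ δ := by exact_mod_cast hδ
          nlinarith
        linarith

/-- Auxiliary lemma `bpα_pos`. [folklore] -/
theorem bpα_pos {d δ : ℕ} (hd : 2 ≤ d) (hδ : d ≤ δ) : 0 < bpα d δ := by
  unfold bpα
  have hp : 0 < bpP d δ := by
    unfold bpP
    refine Nat.mul_pos (by omega) (Finset.sum_pos (fun h hh => ?_)
      ⟨d, Finset.mem_Icc.2 ⟨le_rfl, hδ⟩⟩)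
    have := (Finset.mem_Icc.1 hh).1; omega
  have hE : 1 ≤ bpE d δ := by
    unfold bpE
    rw [Nat.le_div_iff_mul_le (by norm_num)]
    have := bpD_two_le hd hδ
    have : 1 ≤ bpD d δ - 1 := by omega
    nlinarith
  have : (0 : ℝ) < bpP d δ := by exact_mod_cast hp
  have : (0 : ℝ) < bpE d δ := by exact_mod_cast hE
  positivity

/-- **The choice `A = (2(2K₀)^{1/α})^{D-1}`**: then `λ = (2K₀)^{-1/α} < 1` and
`K₀ λ^α = 1/2`. [cite: BombieriPila1989, proof of Theorem 4] -/
theorem goodA {d δ : ℕ} (hd : 2 ≤ d) (hδ : d ≤ δ) :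
    ∃ A : ℝ, 1 ≤ A ∧ 1 < 1 / bpLam d δ A ∧ bpK₀ d δ * bpLam d δ A ^ bpα d δ = 1 / 2 := by
  set α := bpα d δ with hα
  have hαpos : 0 < α := bpα_pos hd hδ
  set K := bpK₀ d δ with hK
  have hK1 : 1 ≤ K := one_le_bpK₀ d δ
  set x : ℝ := 2 * (2 * K) ^ (1 / α) with hx
  have h2K : 1 < 2 * K := by linarith
  have hx2 : 2 ≤ x := by
    have : 1 ≤ (2 * K) ^ (1 / α) := Real.one_le_rpow h2K.le (by positivity)
    rw [hx]; linarith
  set D := bpD d δ with hD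
  have hD2 : 2 ≤ D := bpD_two_le hd hδ
  refine ⟨x ^ (D - 1), ?_, ?_, ?_⟩
  · exact one_le_pow₀ (by linarith)
  · -- `B = x`, `λ = 2/x`, `1/λ = x/2 = (2K)^{1/α} > 1`
    have hB : bpB d δ (x ^ (D - 1)) = x := by
      unfold bpB
      rw [← hD, one_div]
      exact Real.pow_rpow_inv_natCast (by linarith) (by omega)
    unfold bpLam
    rw [hB, one_div_div, hx]
    have : 1 < (2 * K) ^ (1 / α) := Real.one_lt_rpow h2K (by positivity)
    linarith
  · have hB : bpB d δ (x ^ (D - 1)) = x := by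
      unfold bpB
      rw [← hD, one_div]
      exact Real.pow_rpow_inv_natCast (by linarith) (by omega)
    unfold bpLam
    rw [hB, hx]
    have h2K0 : 0 < 2 * K := by linarith
    rw [show (2 : ℝ) / (2 * (2 * K) ^ (1 / α)) = ((2 * K) ^ (1 / α))⁻¹ by field_simp]
    rw [Real.inv_rpow (by positivity), ← Real.rpow_mul h2K0.le, one_div,
      inv_mul_cancel₀ hαpos.ne', Real.rpow_one]
    field_simp

/-- The geometric sums are `≤ 2` when `K₀ λ^α = 1/2`. [folklore] -/
theorem bpS_le_two {d δ : ℕ} {A : ℝ} (h : bpK₀ d δ * bpLam d δ A ^ bpα d δ = 1 / 2) (n : ℕ) :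
    bpS d δ A n ≤ 2 := by
  unfold bpS
  rw [h, geom_sum_eq (by norm_num)]
  have : (0 : ℝ) ≤ (1 / 2) ^ n := by positivity
  have h2 : ((1 / 2 : ℝ) ^ n - 1) / (1 / 2 - 1) = 2 * (1 - (1 / 2) ^ n) := by field_simp; ring
  rw [h2]
  linarith

/-- **Bombieri–Pila (1989), Theorem 4 in `N^{1/d+ε}` form**: proof of the named fact
`bombieriPila_graph_card_le`. For `δ = max(2d, ⌈8/ε⌉)` the exponent satisfies
`α ≤ 1/d + 4/δ ≤ 1/d + ε/2`; with `A` as in `goodA` the recursion gives, for every branch piece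
of length `≤ N` with `λ^{-n} ≤ N < λ^{-(n+1)}`, at most `2H N^α + K₀^{n+1} ≤ (2H + K₀) N^α`
lattice points. [cite: BombieriPila1989, Theorem 4] -/
theorem bombieriPila_graph_card_le_holds : bombieriPila_graph_card_le := by
  intro d hd ε hε
  classical
  -- the parameters
  set δ : ℕ := max (2 * d) ⌈8 / ε⌉₊ with hδdef
  have hδ2d : 2 * d ≤ δ := le_max_left _ _
  have hδd : d ≤ δ := by omega
  have hδε : (4 : ℝ) / δ ≤ ε / 2 := by
    have h1 : (8 / ε : ℝ) ≤ ⌈8 / ε⌉₊ := Nat.le_ceil _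
    have h2 : (⌈8 / ε⌉₊ : ℝ) ≤ δ := by exact_mod_cast le_max_right _ _
    have hδpos : (0 : ℝ) < δ := by
      have : (0 : ℝ) < 8 / ε := by positivity
      linarith
    rw [div_le_iff₀ hδpos]
    have h3 : 8 / ε ≤ (δ : ℝ) := h1.trans h2
    rw [div_le_iff₀ hε] at h3
    linarith
  obtain ⟨A, hA1, hlam1, hhalf⟩ := goodA hd hδd
  set α := bpα d δ with hαdef
  have hα0 : 0 ≤ α := bpα_nonneg d δ
  have hαle : α ≤ 1 / (d : ℝ) + ε := by
    have := bpα_le hd hδ2d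
    linarith
  set K₀ := bpK₀ d δ with hK₀def
  set H := bpH d δ A with hHdef
  have hK₀1 : 1 ≤ K₀ := one_le_bpK₀ d δ
  have hH0 : 0 ≤ H := by rw [hHdef]; unfold bpH bpH₁ bpW₁; positivity
  set lam := bpLam d δ A with hlamdef
  have hlam0 : 0 < lam := by
    have : 0 < 1 / lam := lt_trans one_pos hlam1
    have := one_div_pos.1 this
    exact this
  -- the constant
  refine ⟨2 * H + K₀, by positivity, ?_⟩
  intro F hFd hFirr N hN a b f hlen hbr
  -- the lattice abscissae
  set S := graphLatticeAbscissae f a b with hS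
  rcases S.eq_empty_or_nonempty with he | hne
  · rw [he, Finset.card_empty, Nat.cast_zero]
    positivity
  set u : ℝ := (S.min' hne : ℝ) with hu
  set v : ℝ := (S.max' hne : ℝ) with hv
  have hmin := mem_graphLatticeAbscissae.1 (S.min'_mem hne)
  have hmax := mem_graphLatticeAbscissae.1 (S.max'_mem hne)
  have hau : a < u := hmin.1.1
  have hvb : v < b := hmax.1.2
  have huv : u ≤ v := by
    rw [hu, hv]; exact_mod_cast S.min'_le_max' hne
  have hvuN : v - u ≤ N := by linarith [hmin.1.2, hmax.1.1]
  -- `S` is counted by `latticeCount f u v`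
  have hcount : (S.card : ℝ) ≤ latticeCount f u v := by
    unfold latticeCount
    exact_mod_cast Finset.card_le_card (fun m hm => by
      have hm' := mem_graphLatticeAbscissae.1 hm
      refine mem_latticeCount_set.2 ⟨⟨?_, ?_⟩, hm'.2⟩
      · rw [hu]; exact_mod_cast S.min'_le m hm
      · rw [hv]; exact_mod_cast S.le_max' m hm)
  -- the scale `n`
  obtain ⟨n, hn1, hn2⟩ := exists_nat_pow_near hN hlam1
  have hrec := recursion hd hδd hA1 (n + 1) F hFd hFirr a b f hbr u v hau huv hvb N
    (by linarith) hvuN hn2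
  have hS2 := bpS_le_two hhalf (n + 1)
  -- `K₀^n ≤ N^α`
  have hK₀pow : K₀ ^ n ≤ N ^ α := by
    have h1 : K₀ = (1 / lam) ^ α / 2 := by
      rw [hK₀def, hlamdef, hαdef]
      have hK0' : 0 < bpK₀ d δ := by linarith [one_le_bpK₀ d δ]
      have hl : bpLam d δ A ^ bpα d δ = 1 / (2 * bpK₀ d δ) := by
        rw [eq_div_iff (by positivity)]
        linarith [hhalf]
      rw [Real.div_rpow zero_le_one (le_of_lt (by rw [← hlamdef]; exact hlam0)), Real.one_rpow, hl]
      field_simp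
    have h2 : K₀ ≤ (1 / lam) ^ α := by
      rw [h1]
      have : 0 ≤ (1 / lam) ^ α := by positivity
      linarith
    calc K₀ ^ n ≤ ((1 / lam) ^ α) ^ n := pow_le_pow_left₀ (by linarith) h2 n
      _ = ((1 / lam) ^ n) ^ α := by
          rw [← Real.rpow_natCast, ← Real.rpow_natCast, ← Real.rpow_mul (by positivity),
            ← Real.rpow_mul (by positivity), mul_comm]
      _ ≤ N ^ α := Real.rpow_le_rpow (by positivity) hn1 hα0
  -- conclusion
  have hNα : N ^ α ≤ N ^ (1 / (d : ℝ) + ε) := Real.rpow_le_rpow_of_exponent_le hN hαle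
  have hNα0 : 0 ≤ N ^ α := by positivity
  calc (S.card : ℝ) ≤ latticeCount f u v := hcount
    _ ≤ H * N ^ α * bpS d δ A (n + 1) + K₀ ^ (n + 1) := hrec
    _ ≤ H * N ^ α * 2 + K₀ * N ^ α := by
        rw [pow_succ, mul_comm (K₀ ^ n) K₀]
        gcongr
    _ = (2 * H + K₀) * N ^ α := by ring
    _ ≤ (2 * H + K₀) * N ^ (1 / (d : ℝ) + ε) := by gcongr

end Final

end Literature.NumberTheory.DiophantineGeometry.Dioph
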